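import Literature.Analysis.FluidPDE.CKNLocalEnergyBound
import Literature.Analysis.FluidPDE.CKNPressureEstimateForce
import HarnessLib

/-!
# Lemarié-Rieusset's Lemma 14.2, proved: `lemarieRieusset_lemma_14_2_holds`

Analysis/FluidPDE proof file (no definitions, no named facts) for the named fact
`Literature.Analysis.FluidPDE.lemarieRieusset_lemma_14_2` (`CKNEpsilonRegularityProofs.lean`:
P. G. Lemarié-Rieusset, *The Navier–Stokes Problem in the 21st Century*, §14.3, Lemma 14.2,
scan pp. 507–508 — under the §14.3 hypotheses (`IsLRSuitableWeakSolutionOn`, viscosity `ν > 0`,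
force `f ∈ L^q_t L^q_x`, `q ≥ 5/3`), the one-scale smallness
`∫∫_{Q_{r₀}(z₀)} (|u|³ + |p|^{3/2}) ≤ λ³ r₀²`, `∫∫_{Q_{r₀}(z₀)} |f|^q ≤ λ^{2q} r₀^{5-3q}`, `λ ≤ ε₁`,
propagates to `∫∫_{Q_r(z)} (|u|³ + |p|^{3/2}) ≤ C₃ λ³ r²` for every `z ∈ Q_{3r₀/4}(z₀)` and
`0 < r ≤ r₀/8`).

## The proof

The printed proof (pp. 505–507) iterates two two-scale inequalities, (14.19) for
`w_r = r⁻² ∬_{Q_r} |u|³` (local energy inequality with Scheffer's test function, then the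
interpolation inequality) and (14.20) for `p_r = r⁻² ∬_{Q_r} |p|^{3/2}` (splitting of the localised
pressure into harmonic, Calderón–Zygmund and force parts), along `ρ_n = κⁿ r₀/8` at each centre,
with an invariant region for `χ_n = w + η p` (the exponents of the printed (14.20) are off by the
division by `r²`, see the module docstring of `CKNEpsilonRegularityProofs`; the iteration closes
all the same). Here the same iteration is run in the scaled quantities of the tree
(`A = cknAEss`, `E = cknE`, `C = cknC`, `D = cknD`, `F_q = cknF q` on backward cylinders), at
`ν = 1`, `r₀ = 1`, along `s_n = θⁿ/16` at each centre `z ∈ Q_{3/4}(z₀)`, with the state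
`(Y, D) = (A + E, D)` and the three inequalities

* `A(θR) + E(θR) ≤ c₁θ²C(R)^{2/3} + c₂θ⁻²C(R) + c₃θ⁻²D(R)^{2/3}C(R)^{1/3} + c₄θ⁻¹F_q(R)^{1/q}C(R)^{1/3}`
  (`localEnergyBound`, `CKNLocalEnergyBound.lean`: the local energy inequality with Scheffer's
  test function, cubic term bounded crudely — the first display of p. 506),
* `C(R) ≤ C₀ (A(R) + E(R))^{3/2}` (`exists_cknC_le_rpow`, the interpolation inequality of p. 506),
* `D(θR) ≤ κ₅θ^{-3/2}A(R)^{3/4}E(R)^{3/4} + κ₆θD(R) + 4κ₇θ⁻²F_q(2R; w)^{3/(2q)}`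
  (`pressureEstimate_force`, `CKNPressureEstimateForce.lean`: the pressure estimate with the
  force part absorbed, i.e. (14.20)),

normalised by `λ` (`Y ~ λ²`, `C, D ~ λ³`, `F_q^{1/q} ~ λ²`; the hypothesis `q ≥ 5/3` is exactly what
makes `F_q(s) = s^{3q-5} ∬_{Q_s} |f|^q ≤ λ^{2q}` for all `s ≤ 1`, p. 507: "`sup_ρ f_ρ ≤ … ≤ C' λ³`").
The invariant region `Y ≤ M_y λ²`, `D ≤ M_d λ³` is entered at `s₀ = 1/16` by the first inequality
applied once between `1/8` and `1/16` (this is why the crude cubic term is needed: no energy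
quantity of the large cylinder may appear on the right) and is preserved for `λ ≤ ε₁(q)`.
Then (`Lemma142.lemma_14_2_nu_one`) all scales at `ν = 1` by the Navier–Stokes scaling,
exactly as the accepted `lemarieRieusset_lemma_14_2_of_unitScale`; and
(`Lemma142.lemma_14_2_of_nu_one`) every viscosity: the substitution `u'(s,y) = ν⁻¹ u(t₀ + s/ν, x₀ + y)` has viscosity `1` and maps
backward cylinders onto cylinders of aspect ratio `ν`, which are covered by `⌈2ν⌉ + 1` standard
cylinders of the same radius centred in the `3/4`-core of admissible cylinders of radius
`min(1/2, √ν/2) r₀` ("constants which depend only on `ν` and `q`").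

## References

* P. G. Lemarié-Rieusset, *The Navier–Stokes Problem in the 21st Century*, 2nd ed., CRC Press,
  §14.3, Lemma 14.2 and its proof (scan pp. 505–508). [Lemarierieusset2023]
* L. Caffarelli, R. Kohn, L. Nirenberg, *Partial regularity of suitable weak solutions of the
  Navier–Stokes equations*, Comm. Pure Appl. Math. 35 (1982), §2 (scaling), Proposition 1.
  [CaffarelliKohnNirenberg1982]
-/

noncomputable section

open MeasureTheory Set Function Filter Topology TopologicalSpace Metric
open scoped NNReal ENNReal InnerProductSpace RealInnerProductSpace Laplacian

namespace Literature.Analysis.FluidPDE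

/-- Local notation for physical space `ℝ³ = EuclideanSpace ℝ (Fin 3)`. -/
local notation "ℝ³" => EuclideanSpace ℝ (Fin 3)

namespace Lemma142

/-! ### Geometry of the cylinders used in the iteration -/

/-- For `z ∈ Q_{3/4}(z₀)` and `0 < s ≤ 1/4`, the closed cylinder `closure Q_s(z)` lies in the open
unit cylinder `Q_1(z₀)` (the centre `z` is strictly below the top of `Q_1(z₀)`). [folklore] -/
theorem closure_subset_unit {z₀ z : ℝ × ℝ³} (hz : z ∈ parabolicCylinder (3 / 4) z₀) {s : ℝ}
    (hs : 0 < s) (hs4 : s ≤ 1 / 4) :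
    closure (parabolicCylinder s z) ⊆ parabolicCylinder 1 z₀ := by
  refine (closure_parabolicCylinder_subset s z).trans ?_
  rw [mem_parabolicCylinder] at hz
  obtain ⟨⟨hz1, hz2⟩, hz3⟩ := hz
  rintro ⟨t, x⟩ ⟨⟨ht1, ht2⟩, hx⟩
  rw [mem_closedBall] at hx
  rw [mem_parabolicCylinder]
  refine ⟨⟨?_, lt_of_le_of_lt ht2 hz2⟩, ?_⟩
  · dsimp only at ht1 ⊢
    nlinarith
  · calc dist x z₀.2 ≤ dist x z.2 + dist z.2 z₀.2 := dist_triangle _ _ _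
      _ < s + 3 / 4 := add_lt_add_of_le_of_lt hx hz3
      _ ≤ 1 := by linarith

/-- **The absorption cylinder.** For `z ∈ Q_{3/4}(z₀)` and `0 < s ≤ 1/8` there is a centre `w`
(slightly in the future of `z`) with `closure Q_s(z) ⊆ Q_{2s}(w) ⊆ Q_1(z₀)`. [folklore] -/
theorem exists_absorption_center {z₀ z : ℝ × ℝ³} (hz : z ∈ parabolicCylinder (3 / 4) z₀) {s : ℝ}
    (hs : 0 < s) (hs8 : s ≤ 1 / 8) :
    ∃ w : ℝ × ℝ³, closure (parabolicCylinder s z) ⊆ parabolicCylinder (2 * s) w ∧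
      parabolicCylinder (2 * s) w ⊆ parabolicCylinder 1 z₀ := by
  rw [mem_parabolicCylinder] at hz
  obtain ⟨⟨hz1, hz2⟩, hz3⟩ := hz
  set h : ℝ := min ((z₀.1 - z.1) / 2) (s ^ 2) with hh
  have hh0 : 0 < h := lt_min (by linarith) (by positivity)
  have hh1 : h ≤ (z₀.1 - z.1) / 2 := min_le_left _ _
  have hh2 : h ≤ s ^ 2 := min_le_right _ _
  refine ⟨(z.1 + h, z.2), ?_, ?_⟩
  · refine (closure_parabolicCylinder_subset s z).trans ?_
    rintro ⟨t, x⟩ ⟨⟨ht1, ht2⟩, hx⟩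
    rw [mem_closedBall] at hx
    rw [mem_parabolicCylinder]
    refine ⟨⟨?_, ?_⟩, ?_⟩
    · dsimp only at ht1 ⊢; nlinarith
    · dsimp only at ht2 ⊢; linarith
    · exact lt_of_le_of_lt hx (by linarith)
  · rintro ⟨t, x⟩ htx
    rw [mem_parabolicCylinder] at htx ⊢
    obtain ⟨⟨ht1, ht2⟩, hx⟩ := htx
    dsimp only at ht1 ht2 hx
    refine ⟨⟨by nlinarith, by linarith⟩, ?_⟩
    calc dist x z₀.2 ≤ dist x z.2 + dist z.2 z₀.2 := dist_triangle _ _ _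
      _ < 2 * s + 3 / 4 := add_lt_add hx hz3
      _ ≤ 1 := by linarith

/-! ### Finiteness of the scaled quantities for the §14.3 classes -/

section Finite

variable {Q : Opens (ℝ × ℝ³)} {ν q : ℝ} {f u : ℝ → ℝ³ → ℝ³} {p : ℝ → ℝ³ → ℝ}
  {G : ℝ → ℝ³ → ℝ³ →L[ℝ] ℝ³}

/-- `A(s; z) < ∞` for `Q_s(z) ⊆ Q`, `s > 0`, under `u ∈ L^∞_t L²_x(Q)`. [folklore] -/
theorem cknAEss_ne_top (h : IsLRSuitableWeakSolutionOn Q ν q f u p G) {s : ℝ} (hs : 0 < s)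
    {z : ℝ × ℝ³} (hsub : parabolicCylinder s z ⊆ (Q : Set (ℝ × ℝ³))) : cknAEss s z u ≠ ∞ := by
  obtain ⟨C, hC⟩ := h.energyClass
  have hbound : ∀ᵐ t ∂(volume.restrict (Ioo (z.1 - s ^ 2) z.1)),
      (ENNReal.ofReal s)⁻¹ * ∫⁻ x in ball z.2 s, ‖u t x‖ₑ ^ 2 ≤ (ENNReal.ofReal s)⁻¹ * C := by
    refine (ae_restrict_iff' measurableSet_Ioo).2 (hC.mono fun t ht htI => ?_)
    gcongr
    refine le_trans ?_ ht
    rw [← lintegral_indicator measurableSet_ball]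
    refine lintegral_mono fun x => ?_
    by_cases hx : x ∈ ball z.2 s
    · have hz : (t, x) ∈ (Q : Set (ℝ × ℝ³)) := hsub (by rw [mem_parabolicCylinder]; exact ⟨htI, hx⟩)
      rw [indicator_of_mem hx, indicator_of_mem hz]
    · rw [indicator_of_notMem hx]; exact zero_le
  have : cknAEss s z u ≤ (ENNReal.ofReal s)⁻¹ * C := essSup_le_of_ae_le _ hbound
  exact ne_top_of_le_ne_top
    (ENNReal.mul_ne_top (ENNReal.inv_ne_top.2 (ENNReal.ofReal_pos.2 hs).ne') ENNReal.coe_ne_top) this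

/-- `E(s; z) < ∞` for `Q_s(z) ⊆ Q`, `s > 0`, under `∇u ∈ L²(Q)`. [folklore] -/
theorem cknE_ne_top (h : IsLRSuitableWeakSolutionOn Q ν q f u p G) {s : ℝ} (hs : 0 < s)
    {z : ℝ × ℝ³} (hsub : parabolicCylinder s z ⊆ (Q : Set (ℝ × ℝ³))) : cknE s z G ≠ ∞ := by
  refine ENNReal.mul_ne_top (ENNReal.inv_ne_top.2 (ENNReal.ofReal_pos.2 hs).ne') ?_
  exact (lt_of_le_of_lt (lintegral_mono_set hsub) h.gradient_lt_top).ne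

end Finite

/-! ### Bounds of `C`, `D`, `F_q` from the one-scale hypothesis -/

section OneScale

variable {q : ℝ} {f u : ℝ → ℝ³ → ℝ³} {p : ℝ → ℝ³ → ℝ} {z₀ : ℝ × ℝ³} {l : ℝ}

/-- `(ofReal s ^ 2)⁻¹ = ofReal (s⁻²)` for `s > 0`. [folklore] -/
theorem inv_ofReal_sq {s : ℝ} (hs : 0 < s) :
    (ENNReal.ofReal s ^ 2)⁻¹ = ENNReal.ofReal ((s ^ 2)⁻¹) := by
  rw [← ENNReal.ofReal_pow hs.le, ENNReal.ofReal_inv_of_pos (by positivity)]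

/-- `C(s; v) ≤ s⁻² λ³` for sub-cylinders of `Q_1(z₀)`. [folklore] -/
theorem cknC_le_of_subset {s : ℝ} (hs : 0 < s) {v : ℝ × ℝ³}
    (hsub : parabolicCylinder s v ⊆ parabolicCylinder 1 z₀)
    (hUP : ∫⁻ w in parabolicCylinder 1 z₀,
      (‖u w.1 w.2‖ₑ ^ (3 : ℕ) + ‖p w.1 w.2‖ₑ ^ (3 / 2 : ℝ)) ≤ ENNReal.ofReal (l ^ 3)) :
    cknC s v u ≤ ENNReal.ofReal ((s ^ 2)⁻¹ * l ^ 3) := by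
  rw [cknC, inv_ofReal_sq hs, ENNReal.ofReal_mul (by positivity)]
  gcongr
  calc ∫⁻ w in parabolicCylinder s v, ‖u w.1 w.2‖ₑ ^ (3 : ℕ)
      ≤ ∫⁻ w in parabolicCylinder s v, (‖u w.1 w.2‖ₑ ^ (3 : ℕ) + ‖p w.1 w.2‖ₑ ^ (3 / 2 : ℝ)) :=
        lintegral_mono fun w => le_self_add
    _ ≤ _ := (lintegral_mono_set hsub).trans hUP

/-- `D(s; v) ≤ s⁻² λ³` for sub-cylinders of `Q_1(z₀)`. [folklore] -/
theorem cknD_le_of_subset {s : ℝ} (hs : 0 < s) {v : ℝ × ℝ³}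
    (hsub : parabolicCylinder s v ⊆ parabolicCylinder 1 z₀)
    (hUP : ∫⁻ w in parabolicCylinder 1 z₀,
      (‖u w.1 w.2‖ₑ ^ (3 : ℕ) + ‖p w.1 w.2‖ₑ ^ (3 / 2 : ℝ)) ≤ ENNReal.ofReal (l ^ 3)) :
    cknD s v p ≤ ENNReal.ofReal ((s ^ 2)⁻¹ * l ^ 3) := by
  rw [cknD, inv_ofReal_sq hs, ENNReal.ofReal_mul (by positivity)]
  gcongr
  calc ∫⁻ w in parabolicCylinder s v, ‖p w.1 w.2‖ₑ ^ (3 / 2 : ℝ)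
      ≤ ∫⁻ w in parabolicCylinder s v, (‖u w.1 w.2‖ₑ ^ (3 : ℕ) + ‖p w.1 w.2‖ₑ ^ (3 / 2 : ℝ)) :=
        lintegral_mono fun w => le_add_self
    _ ≤ _ := (lintegral_mono_set hsub).trans hUP

/-- `F_q(s; v) ≤ λ^{2q}` for sub-cylinders of `Q_1(z₀)` of radius `s ≤ 1`, when `q ≥ 5/3`
(`s^{3q-5} ≤ 1`; Lemarié-Rieusset p. 507: "`sup_{ρ < r₀/8} f_ρ ≤ … ≤ C' λ³`"). [folklore] -/
theorem cknF_le_of_subset (hq : 5 / 3 ≤ q) {s : ℝ} (hs : 0 < s) (hs1 : s ≤ 1) {v : ℝ × ℝ³}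
    (hsub : parabolicCylinder s v ⊆ parabolicCylinder 1 z₀)
    (hF : ∫⁻ w in parabolicCylinder 1 z₀, ‖f w.1 w.2‖ₑ ^ q ≤ ENNReal.ofReal (l ^ (2 * q))) :
    cknF q s v f ≤ ENNReal.ofReal (l ^ (2 * q)) := by
  rw [cknF]
  calc ENNReal.ofReal (s ^ (3 * q - 5)) * ∫⁻ w in parabolicCylinder s v, ‖f w.1 w.2‖ₑ ^ q
      ≤ 1 * ENNReal.ofReal (l ^ (2 * q)) := by
        refine mul_le_mul' ?_ ((lintegral_mono_set hsub).trans hF)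
        rw [← ENNReal.ofReal_one]
        exact ENNReal.ofReal_le_ofReal (Real.rpow_le_one hs.le hs1 (by linarith))
    _ = _ := one_mul _

/-- `F_q(s; v)^{1/q} ≤ λ²`. [folklore] -/
theorem cknF_rpow_inv_le (hq : 5 / 3 ≤ q) (hl : 0 ≤ l) {s : ℝ} (hs : 0 < s) (hs1 : s ≤ 1)
    {v : ℝ × ℝ³} (hsub : parabolicCylinder s v ⊆ parabolicCylinder 1 z₀)
    (hF : ∫⁻ w in parabolicCylinder 1 z₀, ‖f w.1 w.2‖ₑ ^ q ≤ ENNReal.ofReal (l ^ (2 * q))) :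
    cknF q s v f ^ (1 / q) ≤ ENNReal.ofReal (l ^ 2) := by
  have hq0 : 0 < q := by linarith
  calc cknF q s v f ^ (1 / q) ≤ ENNReal.ofReal (l ^ (2 * q)) ^ (1 / q) :=
        ENNReal.rpow_le_rpow (cknF_le_of_subset hq hs hs1 hsub hF) (by positivity)
    _ = ENNReal.ofReal (l ^ 2) := by
        rw [ENNReal.ofReal_rpow_of_nonneg (by positivity) (by positivity), ← Real.rpow_mul hl,
          show 2 * q * (1 / q) = ((2 : ℕ) : ℝ) by rw [Nat.cast_ofNat]; field_simp, Real.rpow_natCast]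

/-- `F_q(s; v)^{3/(2q)} ≤ λ³`. [folklore] -/
theorem cknF_rpow_three_halves_le (hq : 5 / 3 ≤ q) (hl : 0 ≤ l) {s : ℝ} (hs : 0 < s) (hs1 : s ≤ 1)
    {v : ℝ × ℝ³} (hsub : parabolicCylinder s v ⊆ parabolicCylinder 1 z₀)
    (hF : ∫⁻ w in parabolicCylinder 1 z₀, ‖f w.1 w.2‖ₑ ^ q ≤ ENNReal.ofReal (l ^ (2 * q))) :
    cknF q s v f ^ (3 / (2 * q)) ≤ ENNReal.ofReal (l ^ 3) := by
  have hq0 : 0 < q := by linarith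
  calc cknF q s v f ^ (3 / (2 * q)) ≤ ENNReal.ofReal (l ^ (2 * q)) ^ (3 / (2 * q)) :=
        ENNReal.rpow_le_rpow (cknF_le_of_subset hq hs hs1 hsub hF) (by positivity)
    _ = ENNReal.ofReal (l ^ 3) := by
        rw [ENNReal.ofReal_rpow_of_nonneg (by positivity) (by positivity), ← Real.rpow_mul hl,
          show 2 * q * (3 / (2 * q)) = ((3 : ℕ) : ℝ) by rw [Nat.cast_ofNat]; field_simp,
          Real.rpow_natCast]

end OneScale

/-! ### Real-variable bookkeeping: the three inequalities with `ofReal` bounds -/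

section Real

/-- `(x λ³)^{2/3} = x^{2/3} λ²`. [folklore] -/
theorem rpow_two_thirds_mul_cube {x l : ℝ} (hx : 0 ≤ x) (hl : 0 ≤ l) :
    (x * l ^ 3) ^ (2 / 3 : ℝ) = x ^ (2 / 3 : ℝ) * l ^ 2 := by
  rw [Real.mul_rpow hx (by positivity), ← Real.rpow_natCast l 3, ← Real.rpow_mul hl]
  norm_num

/-- `(x λ³)^{1/3} = x^{1/3} λ`. [folklore] -/
theorem rpow_third_mul_cube {x l : ℝ} (hx : 0 ≤ x) (hl : 0 ≤ l) :
    (x * l ^ 3) ^ (1 / 3 : ℝ) = x ^ (1 / 3 : ℝ) * l := by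
  rw [Real.mul_rpow hx (by positivity), ← Real.rpow_natCast l 3, ← Real.rpow_mul hl]
  norm_num

/-- `(x λ²)^{3/2} = x^{3/2} λ³`. [folklore] -/
theorem rpow_three_halves_mul_sq {x l : ℝ} (hx : 0 ≤ x) (hl : 0 ≤ l) :
    (x * l ^ 2) ^ (3 / 2 : ℝ) = x ^ (3 / 2 : ℝ) * l ^ 3 := by
  rw [Real.mul_rpow hx (by positivity), ← Real.rpow_natCast l 2, ← Real.rpow_mul hl]
  norm_num

/-- **The interpolation inequality with an `ofReal` bound**: `C ≤ C₀ Y^{3/2}`, `Y ≤ y` give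
`C ≤ C₀ y^{3/2}`. [folklore] -/
theorem cknC_le_ofReal_of_le {Cc Y : ℝ≥0∞} {C₀ : ℝ≥0} {y : ℝ} (hy : 0 ≤ y)
    (hC : Cc ≤ C₀ * Y ^ (3 / 2 : ℝ)) (hY : Y ≤ ENNReal.ofReal y) :
    Cc ≤ ENNReal.ofReal (C₀ * y ^ (3 / 2 : ℝ)) := by
  refine hC.trans ?_
  rw [ENNReal.ofReal_mul (NNReal.coe_nonneg C₀), ENNReal.ofReal_coe_nnreal,
    ← ENNReal.ofReal_rpow_of_nonneg hy (by norm_num)]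
  gcongr

/-- **The local-energy bound with `ofReal` bounds**: substituting `C ≤ a`, `D ≤ b`, `F_q^{1/q} ≤ φ`
into the right-hand side of `localEnergyBound`. [folklore] -/
theorem stepY_le {Y' Cc D Fq : ℝ≥0∞} {c₁ c₂ c₃ c₄ : ℝ≥0} {θ q a b φ : ℝ} (hθ : 0 < θ)
    (ha : 0 ≤ a) (hb : 0 ≤ b) (hφ : 0 ≤ φ)
    (hY : Y' ≤ c₁ * ENNReal.ofReal (θ ^ 2) * Cc ^ (2 / 3 : ℝ) +
          c₂ * ENNReal.ofReal ((θ ^ 2)⁻¹) * Cc +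
          c₃ * ENNReal.ofReal ((θ ^ 2)⁻¹) * D ^ (2 / 3 : ℝ) * Cc ^ (1 / 3 : ℝ) +
          c₄ * ENNReal.ofReal θ⁻¹ * Fq ^ (1 / q) * Cc ^ (1 / 3 : ℝ))
    (hC : Cc ≤ ENNReal.ofReal a) (hD : D ≤ ENNReal.ofReal b) (hF : Fq ^ (1 / q) ≤ ENNReal.ofReal φ) :
    Y' ≤ ENNReal.ofReal (c₁ * θ ^ 2 * a ^ (2 / 3 : ℝ) + c₂ * (θ ^ 2)⁻¹ * a +
      c₃ * (θ ^ 2)⁻¹ * b ^ (2 / 3 : ℝ) * a ^ (1 / 3 : ℝ) + c₄ * θ⁻¹ * φ * a ^ (1 / 3 : ℝ)) := by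
  refine hY.trans ?_
  have hθ2 : 0 ≤ θ ^ 2 := sq_nonneg θ
  have hθi2 : 0 ≤ (θ ^ 2)⁻¹ := inv_nonneg.2 hθ2
  have hθi : 0 ≤ θ⁻¹ := inv_nonneg.2 hθ.le
  calc _ ≤ c₁ * ENNReal.ofReal (θ ^ 2) * ENNReal.ofReal a ^ (2 / 3 : ℝ) +
          c₂ * ENNReal.ofReal ((θ ^ 2)⁻¹) * ENNReal.ofReal a +
          c₃ * ENNReal.ofReal ((θ ^ 2)⁻¹) * ENNReal.ofReal b ^ (2 / 3 : ℝ) *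
            ENNReal.ofReal a ^ (1 / 3 : ℝ) +
          c₄ * ENNReal.ofReal θ⁻¹ * ENNReal.ofReal φ * ENNReal.ofReal a ^ (1 / 3 : ℝ) := by
        gcongr
    _ = _ := by
        rw [ENNReal.ofReal_rpow_of_nonneg ha (by norm_num), ENNReal.ofReal_rpow_of_nonneg ha (by norm_num),
          ENNReal.ofReal_rpow_of_nonneg hb (by norm_num),
          ← ENNReal.ofReal_coe_nnreal (p := c₁), ← ENNReal.ofReal_coe_nnreal (p := c₂),
          ← ENNReal.ofReal_coe_nnreal (p := c₃), ← ENNReal.ofReal_coe_nnreal (p := c₄)]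
        have h1 : 0 ≤ (c₁ : ℝ) * θ ^ 2 * a ^ (2 / 3 : ℝ) := by positivity
        have h2 : 0 ≤ (c₂ : ℝ) * (θ ^ 2)⁻¹ * a := by positivity
        have h3 : 0 ≤ (c₃ : ℝ) * (θ ^ 2)⁻¹ * b ^ (2 / 3 : ℝ) * a ^ (1 / 3 : ℝ) := by positivity
        have h4 : 0 ≤ (c₄ : ℝ) * θ⁻¹ * φ * a ^ (1 / 3 : ℝ) := by positivity
        rw [ENNReal.ofReal_add (by positivity) h4, ENNReal.ofReal_add (by positivity) h3,
          ENNReal.ofReal_add h1 h2,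
          ENNReal.ofReal_mul (by positivity : 0 ≤ (c₁ : ℝ) * θ ^ 2),
          ENNReal.ofReal_mul (by positivity : 0 ≤ (c₁ : ℝ)),
          ENNReal.ofReal_mul (by positivity : 0 ≤ (c₂ : ℝ) * (θ ^ 2)⁻¹),
          ENNReal.ofReal_mul (by positivity : 0 ≤ (c₂ : ℝ)),
          ENNReal.ofReal_mul (by positivity : 0 ≤ (c₃ : ℝ) * (θ ^ 2)⁻¹ * b ^ (2 / 3 : ℝ)),
          ENNReal.ofReal_mul (by positivity : 0 ≤ (c₃ : ℝ) * (θ ^ 2)⁻¹),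
          ENNReal.ofReal_mul (by positivity : 0 ≤ (c₃ : ℝ)),
          ENNReal.ofReal_mul (by positivity : 0 ≤ (c₄ : ℝ) * θ⁻¹ * φ),
          ENNReal.ofReal_mul (by positivity : 0 ≤ (c₄ : ℝ) * θ⁻¹),
          ENNReal.ofReal_mul (by positivity : 0 ≤ (c₄ : ℝ))]

/-- **The pressure estimate with `ofReal` bounds**: substituting `A, E ≤ y`, `D ≤ b`,
`F_q^{3/(2q)} ≤ ψ` into the right-hand side of `pressureEstimate_force`. [folklore] -/
theorem stepD_le {D' A E D F2 : ℝ≥0∞} {κ₅ κ₆ κ₇ : ℝ≥0} {θ q y b ψ ρ : ℝ} (hθ : 0 < θ)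
    (hy : 0 ≤ y) (hb : 0 ≤ b) (hψ : 0 ≤ ψ) (hρ : 0 ≤ ρ)
    (hD' : D' ≤ κ₅ * ENNReal.ofReal (θ ^ (-(3 / 2 : ℝ))) * A ^ (3 / 4 : ℝ) * E ^ (3 / 4 : ℝ) +
      κ₆ * ENNReal.ofReal θ * D + κ₇ * ENNReal.ofReal ((θ ^ 2)⁻¹ * ρ) * F2 ^ (3 / (2 * q)))
    (hA : A ≤ ENNReal.ofReal y) (hE : E ≤ ENNReal.ofReal y) (hD : D ≤ ENNReal.ofReal b)
    (hF : F2 ^ (3 / (2 * q)) ≤ ENNReal.ofReal ψ) :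
    D' ≤ ENNReal.ofReal (κ₅ * θ ^ (-(3 / 2 : ℝ)) * y ^ (3 / 2 : ℝ) + κ₆ * θ * b +
      κ₇ * ((θ ^ 2)⁻¹ * ρ) * ψ) := by
  refine hD'.trans ?_
  have hθm : 0 ≤ θ ^ (-(3 / 2 : ℝ)) := Real.rpow_nonneg hθ.le _
  have hθρ : 0 ≤ (θ ^ 2)⁻¹ * ρ := by positivity
  have hyy : ENNReal.ofReal y ^ (3 / 4 : ℝ) * ENNReal.ofReal y ^ (3 / 4 : ℝ) =
      ENNReal.ofReal (y ^ (3 / 2 : ℝ)) := by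
    rw [ENNReal.ofReal_rpow_of_nonneg hy (by norm_num), ← ENNReal.ofReal_mul (Real.rpow_nonneg hy _),
      ← Real.rpow_add' hy (by norm_num)]
    norm_num
  calc _ ≤ κ₅ * ENNReal.ofReal (θ ^ (-(3 / 2 : ℝ))) * ENNReal.ofReal y ^ (3 / 4 : ℝ) *
          ENNReal.ofReal y ^ (3 / 4 : ℝ) +
        κ₆ * ENNReal.ofReal θ * ENNReal.ofReal b +
        κ₇ * ENNReal.ofReal ((θ ^ 2)⁻¹ * ρ) * ENNReal.ofReal ψ := by gcongr
    _ = _ := by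
        rw [mul_assoc (κ₅ * ENNReal.ofReal (θ ^ (-(3 / 2 : ℝ)))), hyy,
          ← ENNReal.ofReal_coe_nnreal (p := κ₅), ← ENNReal.ofReal_coe_nnreal (p := κ₆),
          ← ENNReal.ofReal_coe_nnreal (p := κ₇)]
        have h1 : 0 ≤ (κ₅ : ℝ) * θ ^ (-(3 / 2 : ℝ)) * y ^ (3 / 2 : ℝ) := by positivity
        have h2 : 0 ≤ (κ₆ : ℝ) * θ * b := by positivity
        have h3 : 0 ≤ (κ₇ : ℝ) * ((θ ^ 2)⁻¹ * ρ) * ψ := by positivity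
        rw [ENNReal.ofReal_add (by positivity) h3, ENNReal.ofReal_add h1 h2,
          ENNReal.ofReal_mul (by positivity : 0 ≤ (κ₅ : ℝ) * θ ^ (-(3 / 2 : ℝ))),
          ENNReal.ofReal_mul (by positivity : 0 ≤ (κ₅ : ℝ)),
          ENNReal.ofReal_mul (by positivity : 0 ≤ (κ₆ : ℝ) * θ),
          ENNReal.ofReal_mul (by positivity : 0 ≤ (κ₆ : ℝ)),
          ENNReal.ofReal_mul (by positivity : 0 ≤ (κ₇ : ℝ) * ((θ ^ 2)⁻¹ * ρ)),
          ENNReal.ofReal_mul (by positivity : 0 ≤ (κ₇ : ℝ))]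

end Real

/-! ### The core: Lemma 14.2 at `ν = 1`, `r₀ = 1` -/

section Core

/-- Splitting the smallness integrand on a cylinder: `∫∫_{Q_s(z)} (|u|³ + |p|^{3/2}) =
s² (C(s; z) + D(s; z))`, for `u` measurable on the cylinder. [folklore] -/
theorem lintegral_add_eq_sq_mul {u : ℝ → ℝ³ → ℝ³} {p : ℝ → ℝ³ → ℝ} {s : ℝ} (hs : 0 < s)
    {z : ℝ × ℝ³}
    (hum : AEMeasurable (fun w : ℝ × ℝ³ => ‖u w.1 w.2‖ₑ ^ (3 : ℕ))
      (volume.restrict (parabolicCylinder s z))) :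
    ∫⁻ w in parabolicCylinder s z, (‖u w.1 w.2‖ₑ ^ (3 : ℕ) + ‖p w.1 w.2‖ₑ ^ (3 / 2 : ℝ)) =
      ENNReal.ofReal s ^ 2 * (cknC s z u + cknD s z p) := by
  have h0 : ENNReal.ofReal s ^ 2 ≠ 0 := pow_ne_zero _ (ENNReal.ofReal_pos.2 hs).ne'
  have htop : ENNReal.ofReal s ^ 2 ≠ ⊤ := ENNReal.pow_ne_top ENNReal.ofReal_ne_top
  rw [lintegral_add_left' hum, cknC, cknD, mul_add, ← mul_assoc, ← mul_assoc,
    ENNReal.mul_inv_cancel h0 htop, one_mul, one_mul]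

/-! #### The setting of the iteration -/

section Setting

variable {q : ℝ} {Ω : Opens (ℝ × ℝ³)} {f u : ℝ → ℝ³ → ℝ³} {p : ℝ → ℝ³ → ℝ}
  {G : ℝ → ℝ³ → ℝ³ →L[ℝ] ℝ³} {z₀ z : ℝ × ℝ³} {l : ℝ}

variable (hq : 5 / 3 ≤ q) (hS : IsLRSuitableWeakSolutionOn Ω 1 q f u p G)
  (hsub : parabolicCylinder 1 z₀ ⊆ (Ω : Set (ℝ × ℝ³))) (hl : 0 ≤ l)
  (hUP : ∫⁻ w in parabolicCylinder 1 z₀,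
    (‖u w.1 w.2‖ₑ ^ (3 : ℕ) + ‖p w.1 w.2‖ₑ ^ (3 / 2 : ℝ)) ≤ ENNReal.ofReal (l ^ 3))
  (hF : ∫⁻ w in parabolicCylinder 1 z₀, ‖f w.1 w.2‖ₑ ^ q ≤ ENNReal.ofReal (l ^ (2 * q)))
  (hz : z ∈ parabolicCylinder (3 / 4) z₀)

-- The shape of the local-energy bound (`localEnergyBound` at `ν = 1`).
set_option quotPrecheck false in
local notation "LEB" c₁ ", " c₂ ", " c₃ ", " c₄ =>
  ∀ (Q : Opens (ℝ × ℝ³)) (q : ℝ) (f u : ℝ → ℝ³ → ℝ³) (p : ℝ → ℝ³ → ℝ)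
    (G : ℝ → ℝ³ → ℝ³ →L[ℝ] ℝ³), IsSuitableWeakSolutionOn Q 1 f u p → 3 / 2 ≤ q →
    MemLp (uncurry f) (ENNReal.ofReal q) (volume.restrict (Q : Set (ℝ × ℝ³))) →
    HasWeakSpatialGradientOn Q u G →
    ∀ (z : ℝ × ℝ³) (R θ : ℝ), 0 < R → 0 < θ → θ ≤ 1 / 2 →
      closure (parabolicCylinder R z) ⊆ (Q : Set (ℝ × ℝ³)) →
      cknAEss (θ * R) z u + cknE (θ * R) z G ≤
        (c₁ : ℝ≥0) * ENNReal.ofReal (θ ^ 2) * cknC R z u ^ (2 / 3 : ℝ) +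
        (c₂ : ℝ≥0) * ENNReal.ofReal ((θ ^ 2)⁻¹) * cknC R z u +
        (c₃ : ℝ≥0) * ENNReal.ofReal ((θ ^ 2)⁻¹) * cknD R z p ^ (2 / 3 : ℝ) * cknC R z u ^ (1 / 3 : ℝ) +
        (c₄ : ℝ≥0) * ENNReal.ofReal θ⁻¹ * cknF q R z f ^ (1 / q) * cknC R z u ^ (1 / 3 : ℝ)

-- The shape of the interpolation inequality (`exists_cknC_le_rpow`).
set_option quotPrecheck false in
local notation "IEB" C₀ =>
  ∀ (u : ℝ → ℝ³ → ℝ³) (G : ℝ → ℝ³ → ℝ³ →L[ℝ] ℝ³) (z : ℝ × ℝ³) (r : ℝ), 0 < r →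
    HasWeakSpatialGradientOn (parabolicCylinderOpens r z) u G →
    cknAEss r z u ≠ ∞ → cknE r z G ≠ ∞ →
    cknC r z u ≤ (C₀ : ℝ≥0) * (cknAEss r z u + cknE r z G) ^ (3 / 2 : ℝ)

-- The shape of the pressure estimate with force (`pressureEstimate_force` at `q`).
set_option quotPrecheck false in
local notation "PEB" q ", " κ₅ ", " κ₆ ", " κ₇ =>
  ∀ (Ω : Opens (ℝ × ℝ³)) (f u : ℝ → ℝ³ → ℝ³) (p : ℝ → ℝ³ → ℝ) (G : ℝ → ℝ³ → ℝ³ →L[ℝ] ℝ³),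
    IsLRSuitableWeakSolutionOn Ω 1 q f u p G →
    ∀ (w z : ℝ × ℝ³) (R r θ : ℝ), 0 < R → 0 < r → 0 < θ → θ ≤ 1 / 2 →
      closure (parabolicCylinder r z) ⊆ parabolicCylinder R w →
      parabolicCylinder R w ⊆ (Ω : Set (ℝ × ℝ³)) →
      ∫⁻ v in parabolicCylinder R w, ‖u v.1 v.2‖ₑ ^ (3 : ℕ) < ⊤ →
      cknD (θ * r) z p ≤
        (κ₅ : ℝ≥0) * ENNReal.ofReal (θ ^ (-(3 / 2 : ℝ))) * cknAEss r z u ^ (3 / 4 : ℝ) *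
            cknE r z G ^ (3 / 4 : ℝ) +
          (κ₆ : ℝ≥0) * ENNReal.ofReal θ * cknD r z p +
          (κ₇ : ℝ≥0) * ENNReal.ofReal ((θ ^ 2)⁻¹ * (R / r) ^ 2) * cknF q R w f ^ (3 / (2 * q))

include hq hS hsub hl hUP hF hz in
/-- **Initialisation.** At the centre `z ∈ Q_{3/4}(z₀)`, with `l ≤ 1`:
`A(1/16) + E(1/16) ≤ (4c₁ + 256c₂ + 256c₃ + 8c₄) λ²` (the local-energy bound between `1/8` and
`1/16`, with `C(1/8), D(1/8) ≤ 64 λ³`, `F_q(1/8)^{1/q} ≤ λ²`) and `D(1/16) ≤ 256 λ³`. [folklore] -/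
theorem core_base {c₁ c₂ c₃ c₄ : ℝ≥0} (hLE : LEB c₁, c₂, c₃, c₄) (hl1 : l ≤ 1) :
    cknAEss (1 / 16) z u + cknE (1 / 16) z G ≤
        ENNReal.ofReal ((4 * c₁ + 256 * c₂ + 256 * c₃ + 8 * c₄) * l ^ 2) ∧
      cknD (1 / 16) z p ≤ ENNReal.ofReal (256 * l ^ 3) := by
  have hq32 : 3 / 2 ≤ q := by linarith
  constructor
  · have hcl : closure (parabolicCylinder (1 / 8) z) ⊆ (Ω : Set (ℝ × ℝ³)) :=
      (closure_subset_unit hz (by norm_num) (by norm_num)).trans hsub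
    have hsub8 : parabolicCylinder (1 / 8) z ⊆ parabolicCylinder 1 z₀ :=
      subset_closure.trans (closure_subset_unit hz (by norm_num) (by norm_num))
    have key := hLE Ω q f u p G hS.isSuitableWeakSolutionOn hq32
      (hS.force_memLp) hS.weakGradient z (1 / 8) (1 / 2) (by norm_num) (by norm_num) le_rfl hcl
    rw [show (1 : ℝ) / 2 * (1 / 8) = 1 / 16 by norm_num] at key
    have hC8 : cknC (1 / 8) z u ≤ ENNReal.ofReal (64 * l ^ 3) := by
      have := cknC_le_of_subset (by norm_num : (0 : ℝ) < 1 / 8) hsub8 hUP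
      rwa [show ((1 : ℝ) / 8) ^ 2 = 1 / 64 by norm_num, inv_div, div_one] at this
    have hD8 : cknD (1 / 8) z p ≤ ENNReal.ofReal (64 * l ^ 3) := by
      have := cknD_le_of_subset (by norm_num : (0 : ℝ) < 1 / 8) hsub8 hUP
      rwa [show ((1 : ℝ) / 8) ^ 2 = 1 / 64 by norm_num, inv_div, div_one] at this
    have hF8 : cknF q (1 / 8) z f ^ (1 / q) ≤ ENNReal.ofReal (l ^ 2) :=
      cknF_rpow_inv_le hq hl (by norm_num) (by norm_num) hsub8 hF
    have hbound := stepY_le (by norm_num : (0 : ℝ) < 1 / 2) (by positivity) (by positivity)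
      (by positivity) key hC8 hD8 hF8
    refine hbound.trans (ENNReal.ofReal_le_ofReal ?_)
    have e1 : ((64 : ℝ) * l ^ 3) ^ (2 / 3 : ℝ) = 16 * l ^ 2 := by
      rw [rpow_two_thirds_mul_cube (by norm_num) hl]
      congr 1
      rw [show (64 : ℝ) = 4 ^ (3 : ℕ) by norm_num, ← Real.rpow_natCast, ← Real.rpow_mul (by norm_num)]
      norm_num
    have e2 : ((64 : ℝ) * l ^ 3) ^ (1 / 3 : ℝ) = 4 * l := by
      rw [rpow_third_mul_cube (by norm_num) hl]
      congr 1
      rw [show (64 : ℝ) = 4 ^ (3 : ℕ) by norm_num, ← Real.rpow_natCast, ← Real.rpow_mul (by norm_num)]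
      norm_num
    rw [e1, e2]
    have hl2 : l ^ 3 ≤ l ^ 2 := by nlinarith [pow_nonneg hl 2]
    have h1 : (c₁ : ℝ) * (1 / 2) ^ 2 * (16 * l ^ 2) = 4 * c₁ * l ^ 2 := by ring
    have h2 : (c₂ : ℝ) * ((1 / 2) ^ 2)⁻¹ * (64 * l ^ 3) = 256 * c₂ * l ^ 3 := by norm_num; ring
    have h3 : (c₃ : ℝ) * ((1 / 2) ^ 2)⁻¹ * (16 * l ^ 2) * (4 * l) = 256 * c₃ * l ^ 3 := by
      norm_num; ring
    have h4 : (c₄ : ℝ) * (1 / 2)⁻¹ * l ^ 2 * (4 * l) = 8 * c₄ * l ^ 3 := by norm_num; ring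
    have k2 : 256 * c₂ * l ^ 3 ≤ 256 * c₂ * l ^ 2 := mul_le_mul_of_nonneg_left hl2 (by positivity)
    have k3 : 256 * c₃ * l ^ 3 ≤ 256 * c₃ * l ^ 2 := mul_le_mul_of_nonneg_left hl2 (by positivity)
    have k4 : 8 * c₄ * l ^ 3 ≤ 8 * c₄ * l ^ 2 := mul_le_mul_of_nonneg_left hl2 (by positivity)
    have eM : (4 * c₁ + 256 * c₂ + 256 * c₃ + 8 * c₄) * l ^ 2 =
        4 * c₁ * l ^ 2 + 256 * c₂ * l ^ 2 + 256 * c₃ * l ^ 2 + 8 * c₄ * l ^ 2 := by ring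
    rw [h1, h2, h3, h4, eM]
    linarith
  · have hsub16 : parabolicCylinder (1 / 16) z ⊆ parabolicCylinder 1 z₀ :=
      subset_closure.trans (closure_subset_unit hz (by norm_num) (by norm_num))
    have := cknD_le_of_subset (by norm_num : (0 : ℝ) < 1 / 16) hsub16 hUP
    rwa [show ((1 : ℝ) / 16) ^ 2 = 1 / 256 by norm_num, inv_div, div_one] at this

include hq hS hsub hl hF hz in
/-- **The energy step.** If `A(s) + E(s) ≤ My λ²` and `D(s) ≤ Md λ³` at the centre `z`,
`0 < s ≤ 1/4`, then `A(θs) + E(θs) ≤ My λ²`, provided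
`c₁θ²Ac^{2/3} + λ (c₂θ⁻²Ac + c₃θ⁻²Md^{2/3}Ac^{1/3} + c₄θ⁻¹Ac^{1/3}) ≤ My`, `Ac = C₀ My^{3/2}`.
[folklore] -/
theorem core_stepY {c₁ c₂ c₃ c₄ C₀ : ℝ≥0} (hLE : LEB c₁, c₂, c₃, c₄) (hC₀ : IEB C₀)
    {θ My Md : ℝ} (hθ0 : 0 < θ) (hθ2 : θ ≤ 1 / 2) (hMy : 0 ≤ My) (hMd : 0 ≤ Md)
    (halg : c₁ * θ ^ 2 * (C₀ * My ^ (3 / 2 : ℝ)) ^ (2 / 3 : ℝ) +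
      l * (c₂ * (θ ^ 2)⁻¹ * (C₀ * My ^ (3 / 2 : ℝ)) +
        c₃ * (θ ^ 2)⁻¹ * Md ^ (2 / 3 : ℝ) * (C₀ * My ^ (3 / 2 : ℝ)) ^ (1 / 3 : ℝ) +
        c₄ * θ⁻¹ * (C₀ * My ^ (3 / 2 : ℝ)) ^ (1 / 3 : ℝ)) ≤ My)
    {s : ℝ} (hs : 0 < s) (hs4 : s ≤ 1 / 4)
    (hY : cknAEss s z u + cknE s z G ≤ ENNReal.ofReal (My * l ^ 2))
    (hD : cknD s z p ≤ ENNReal.ofReal (Md * l ^ 3)) :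
    cknAEss (θ * s) z u + cknE (θ * s) z G ≤ ENNReal.ofReal (My * l ^ 2) := by
  have hq32 : 3 / 2 ≤ q := by linarith
  set Ac : ℝ := C₀ * My ^ (3 / 2 : ℝ) with hAc
  have hAc0 : 0 ≤ Ac := by positivity
  have hs1 : s ≤ 1 := by linarith
  have hcl : closure (parabolicCylinder s z) ⊆ parabolicCylinder 1 z₀ := closure_subset_unit hz hs hs4
  have hsub_s : parabolicCylinder s z ⊆ parabolicCylinder 1 z₀ := subset_closure.trans hcl
  have hAtop : cknAEss s z u ≠ ⊤ := ne_top_of_le_ne_top ENNReal.ofReal_ne_top (le_self_add.trans hY)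
  have hEtop : cknE s z G ≠ ⊤ := ne_top_of_le_ne_top ENNReal.ofReal_ne_top (le_add_self.trans hY)
  have hGs : HasWeakSpatialGradientOn (parabolicCylinderOpens s z) u G :=
    hS.weakGradient.mono (show (parabolicCylinderOpens s z : Opens (ℝ × ℝ³)) ≤ Ω from
      fun v hv => hsub (hsub_s (by rwa [← coe_parabolicCylinderOpens])))
  have hC : cknC s z u ≤ ENNReal.ofReal (Ac * l ^ 3) := by
    have h1 := cknC_le_ofReal_of_le (mul_nonneg hMy (pow_nonneg hl 2)) (hC₀ u G z s hs hGs hAtop hEtop) hY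
    rw [rpow_three_halves_mul_sq hMy hl] at h1
    rwa [hAc, mul_assoc]
  have hFs : cknF q s z f ^ (1 / q) ≤ ENNReal.ofReal (l ^ 2) := cknF_rpow_inv_le hq hl hs hs1 hsub_s hF
  have key := hLE Ω q f u p G hS.isSuitableWeakSolutionOn hq32 hS.force_memLp hS.weakGradient z s θ
    hs hθ0 hθ2 (hcl.trans hsub)
  have hbound := stepY_le hθ0 (by positivity) (by positivity) (by positivity) key hC hD hFs
  refine hbound.trans (ENNReal.ofReal_le_ofReal ?_)
  rw [rpow_two_thirds_mul_cube hAc0 hl, rpow_third_mul_cube hAc0 hl, rpow_two_thirds_mul_cube hMd hl]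
  have e : c₁ * θ ^ 2 * (Ac ^ (2 / 3 : ℝ) * l ^ 2) + c₂ * (θ ^ 2)⁻¹ * (Ac * l ^ 3) +
      c₃ * (θ ^ 2)⁻¹ * (Md ^ (2 / 3 : ℝ) * l ^ 2) * (Ac ^ (1 / 3 : ℝ) * l) +
      c₄ * θ⁻¹ * l ^ 2 * (Ac ^ (1 / 3 : ℝ) * l) =
      l ^ 2 * (c₁ * θ ^ 2 * Ac ^ (2 / 3 : ℝ) + l * (c₂ * (θ ^ 2)⁻¹ * Ac +
        c₃ * (θ ^ 2)⁻¹ * Md ^ (2 / 3 : ℝ) * Ac ^ (1 / 3 : ℝ) + c₄ * θ⁻¹ * Ac ^ (1 / 3 : ℝ))) := by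
    ring
  rw [e]
  calc _ ≤ l ^ 2 * My := mul_le_mul_of_nonneg_left halg (pow_nonneg hl 2)
    _ = My * l ^ 2 := mul_comm _ _

include hq hS hsub hl hUP hF hz in
/-- **The pressure step.** If `A(s) + E(s) ≤ My λ²` and `D(s) ≤ Md λ³` at `z`, `0 < s ≤ 1/8`, then
`D(θs) ≤ Md λ³`, provided `κ₅θ^{-3/2}My^{3/2} + 4κ₇θ⁻² + κ₆θMd ≤ Md` (the pressure estimate
through the absorption cylinder `Q_{2s}(w) ⊆ Q_1(z₀)`). [folklore] -/
theorem core_stepD {κ₅ κ₆ κ₇ : ℝ≥0} (hPE : PEB q, κ₅, κ₆, κ₇) {θ My Md : ℝ} (hθ0 : 0 < θ)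
    (hθ2 : θ ≤ 1 / 2) (hMy : 0 ≤ My) (hMd : 0 ≤ Md)
    (halg : κ₅ * θ ^ (-(3 / 2 : ℝ)) * My ^ (3 / 2 : ℝ) + 4 * κ₇ * (θ ^ 2)⁻¹ + κ₆ * θ * Md ≤ Md)
    {s : ℝ} (hs : 0 < s) (hs8 : s ≤ 1 / 8)
    (hY : cknAEss s z u + cknE s z G ≤ ENNReal.ofReal (My * l ^ 2))
    (hD : cknD s z p ≤ ENNReal.ofReal (Md * l ^ 3)) :
    cknD (θ * s) z p ≤ ENNReal.ofReal (Md * l ^ 3) := by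
  have hA : cknAEss s z u ≤ ENNReal.ofReal (My * l ^ 2) := le_trans le_self_add hY
  have hE : cknE s z G ≤ ENNReal.ofReal (My * l ^ 2) := le_trans le_add_self hY
  obtain ⟨w, hclw, hwsub⟩ := exists_absorption_center hz hs hs8
  have h2s1 : 2 * s ≤ 1 := by linarith
  have hu3 : ∫⁻ v in parabolicCylinder (2 * s) w, ‖u v.1 v.2‖ₑ ^ (3 : ℕ) < ⊤ := by
    refine lt_of_le_of_lt ?_ (ENNReal.ofReal_lt_top (r := l ^ 3))
    calc ∫⁻ v in parabolicCylinder (2 * s) w, ‖u v.1 v.2‖ₑ ^ (3 : ℕ)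
        ≤ ∫⁻ v in parabolicCylinder (2 * s) w, (‖u v.1 v.2‖ₑ ^ (3 : ℕ) + ‖p v.1 v.2‖ₑ ^ (3 / 2 : ℝ)) :=
          lintegral_mono fun v => le_self_add
      _ ≤ _ := (lintegral_mono_set hwsub).trans hUP
  have key := hPE Ω f u p G hS w z (2 * s) s θ (by positivity) hs hθ0 hθ2 hclw (hwsub.trans hsub) hu3
  have hF2 : cknF q (2 * s) w f ^ (3 / (2 * q)) ≤ ENNReal.ofReal (l ^ 3) :=
    cknF_rpow_three_halves_le hq hl (by positivity) h2s1 hwsub hF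
  have hρ : 2 * s / s = 2 := by field_simp
  rw [hρ] at key
  have hbound := stepD_le hθ0 (by positivity : 0 ≤ My * l ^ 2) (by positivity : 0 ≤ Md * l ^ 3)
    (by positivity : 0 ≤ l ^ 3) (by norm_num : (0 : ℝ) ≤ 2 ^ 2) key hA hE hD hF2
  refine hbound.trans (ENNReal.ofReal_le_ofReal ?_)
  rw [rpow_three_halves_mul_sq hMy hl]
  have e : κ₅ * θ ^ (-(3 / 2 : ℝ)) * (My ^ (3 / 2 : ℝ) * l ^ 3) + κ₆ * θ * (Md * l ^ 3) +
      κ₇ * ((θ ^ 2)⁻¹ * 2 ^ 2) * l ^ 3 =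
      l ^ 3 * (κ₅ * θ ^ (-(3 / 2 : ℝ)) * My ^ (3 / 2 : ℝ) + 4 * κ₇ * (θ ^ 2)⁻¹ + κ₆ * θ * Md) := by
    ring
  rw [e]
  calc l ^ 3 * _ ≤ l ^ 3 * Md := mul_le_mul_of_nonneg_left halg (pow_nonneg hl 3)
    _ = Md * l ^ 3 := mul_comm _ _

include hS hsub hl hUP hz in
/-- **From the scales `θⁿ/16` to every radius.** If along `s_n = θⁿ/16` at the centre `z`
one has `A + E ≤ My λ²` and `D ≤ Md λ³`, then for every `0 < r ≤ 1/8`,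
`∫∫_{Q_r(z)} (|u|³ + |p|^{3/2}) ≤ max(256, (C₀My^{3/2} + Md)θ⁻²) λ³ r²`. [folklore] -/
theorem core_final {C₀ : ℝ≥0} (hC₀ : IEB C₀) {θ My Md : ℝ} (hθ0 : 0 < θ) (hθ1 : θ < 1)
    (hMy : 0 ≤ My) (hMd : 0 ≤ Md)
    (hstate : ∀ n : ℕ, cknAEss (θ ^ n * (1 / 16)) z u + cknE (θ ^ n * (1 / 16)) z G ≤
        ENNReal.ofReal (My * l ^ 2) ∧ cknD (θ ^ n * (1 / 16)) z p ≤ ENNReal.ofReal (Md * l ^ 3))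
    {r : ℝ} (hr : 0 < r) (hr8 : r ≤ 1 / 8) :
    ∫⁻ w in parabolicCylinder r z, (‖u w.1 w.2‖ₑ ^ (3 : ℕ) + ‖p w.1 w.2‖ₑ ^ (3 / 2 : ℝ)) ≤
      ENNReal.ofReal (max 256 ((C₀ * My ^ (3 / 2 : ℝ) + Md) * (θ ^ 2)⁻¹) * l ^ 3 * r ^ 2) := by
  set C₃ : ℝ := max 256 ((C₀ * My ^ (3 / 2 : ℝ) + Md) * (θ ^ 2)⁻¹) with hC₃
  set Ac : ℝ := C₀ * My ^ (3 / 2 : ℝ) with hAc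
  set s : ℕ → ℝ := fun n => θ ^ n * (1 / 16) with hsdef
  have hs0 : ∀ n, 0 < s n := fun n => by positivity
  have hs16 : ∀ n, s n ≤ 1 / 16 := fun n => by
    have : θ ^ n ≤ 1 := pow_le_one₀ hθ0.le hθ1.le
    calc s n = θ ^ n * (1 / 16) := rfl
      _ ≤ 1 * (1 / 16) := by gcongr
      _ = 1 / 16 := one_mul _
  have hs_succ : ∀ n, s (n + 1) = θ * s n := fun n => by
    simp only [hsdef, pow_succ]; ring
  by_cases hr16 : 1 / 16 < r
  · -- `r > 1/16`: the trivial bound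
    have hsubr : parabolicCylinder r z ⊆ parabolicCylinder 1 z₀ :=
      parabolicCylinder_subset_of_mem_threeQuarters (r₀ := 1) (by simpa using hz) hr (by linarith)
    calc _ ≤ ENNReal.ofReal (l ^ 3) := (lintegral_mono_set hsubr).trans hUP
      _ ≤ ENNReal.ofReal (C₃ * l ^ 3 * r ^ 2) := by
          refine ENNReal.ofReal_le_ofReal ?_
          have h256 : (256 : ℝ) ≤ C₃ := le_max_left _ _
          have hr2 : 1 ≤ 256 * r ^ 2 := by nlinarith
          have hl3 : 0 ≤ l ^ 3 := pow_nonneg hl 3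
          calc l ^ 3 = 1 * l ^ 3 := (one_mul _).symm
            _ ≤ 256 * r ^ 2 * l ^ 3 := mul_le_mul_of_nonneg_right hr2 hl3
            _ ≤ C₃ * r ^ 2 * l ^ 3 := by gcongr
            _ = C₃ * l ^ 3 * r ^ 2 := by ring
  · have hr16' : r ≤ 1 / 16 := not_lt.1 hr16
    -- the first scale below `r`
    have hex : ∃ n : ℕ, s n < r := by
      obtain ⟨n, hn⟩ := exists_pow_lt_of_lt_one (show 0 < 16 * r by positivity) hθ1
      exact ⟨n, by simp only [hsdef]; linarith⟩
    classical
    have hN : s (Nat.find hex) < r := Nat.find_spec hex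
    have hN0 : Nat.find hex ≠ 0 := by
      intro h0
      have h1 : s 0 < r := by rwa [h0] at hN
      have h2 : s 0 = 1 / 16 := by simp [hsdef]
      linarith
    obtain ⟨m, hm⟩ : ∃ m : ℕ, Nat.find hex = m + 1 := ⟨Nat.find hex - 1, by omega⟩
    have hmr : r ≤ s m := not_lt.1 (Nat.find_min hex (show m < Nat.find hex by omega))
    have hsm : s m < r / θ := by
      rw [lt_div_iff₀ hθ0, mul_comm, ← hs_succ, ← hm]
      exact hN
    obtain ⟨hYm, hDm⟩ := hstate m
    have hsmpos := hs0 m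
    have hsub_m : parabolicCylinder (s m) z ⊆ parabolicCylinder 1 z₀ :=
      subset_closure.trans (closure_subset_unit hz hsmpos ((hs16 m).trans (by norm_num)))
    have hAtop : cknAEss (s m) z u ≠ ⊤ :=
      ne_top_of_le_ne_top ENNReal.ofReal_ne_top (le_self_add.trans hYm)
    have hEtop : cknE (s m) z G ≠ ⊤ :=
      ne_top_of_le_ne_top ENNReal.ofReal_ne_top (le_add_self.trans hYm)
    have hGm : HasWeakSpatialGradientOn (parabolicCylinderOpens (s m) z) u G :=
      hS.weakGradient.mono (show (parabolicCylinderOpens (s m) z : Opens (ℝ × ℝ³)) ≤ Ω from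
        fun v hv => hsub (hsub_m (by rwa [← coe_parabolicCylinderOpens])))
    have hCm : cknC (s m) z u ≤ ENNReal.ofReal (Ac * l ^ 3) := by
      have h1 := cknC_le_ofReal_of_le (mul_nonneg hMy (pow_nonneg hl 2))
        (hC₀ u G z (s m) hsmpos hGm hAtop hEtop) hYm
      rw [rpow_three_halves_mul_sq hMy hl] at h1
      rwa [hAc, mul_assoc]
    -- measurability of `|u|³` on the cylinder
    have hum : AEMeasurable (fun w : ℝ × ℝ³ => ‖u w.1 w.2‖ₑ ^ (3 : ℕ))
        (volume.restrict (parabolicCylinder (s m) z)) := by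
      have h1 := (hS.weakGradient.locallyIntegrableOn.aestronglyMeasurable).mono_measure
        (Measure.restrict_mono (hsub_m.trans hsub) le_rfl)
      exact h1.aemeasurable.enorm.pow_const 3
    calc ∫⁻ w in parabolicCylinder r z, (‖u w.1 w.2‖ₑ ^ (3 : ℕ) + ‖p w.1 w.2‖ₑ ^ (3 / 2 : ℝ))
        ≤ ∫⁻ w in parabolicCylinder (s m) z, (‖u w.1 w.2‖ₑ ^ (3 : ℕ) + ‖p w.1 w.2‖ₑ ^ (3 / 2 : ℝ)) :=
          lintegral_mono_set (parabolicCylinder_mono hr.le hmr z)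
      _ = ENNReal.ofReal (s m) ^ 2 * (cknC (s m) z u + cknD (s m) z p) :=
          lintegral_add_eq_sq_mul hsmpos hum
      _ ≤ ENNReal.ofReal (s m) ^ 2 * (ENNReal.ofReal (Ac * l ^ 3) + ENNReal.ofReal (Md * l ^ 3)) := by
          gcongr
      _ = ENNReal.ofReal ((s m) ^ 2 * ((Ac + Md) * l ^ 3)) := by
          rw [← ENNReal.ofReal_add (by positivity) (by positivity), ← ENNReal.ofReal_pow hsmpos.le,
            ← ENNReal.ofReal_mul (by positivity)]
          congr 1; ring
      _ ≤ ENNReal.ofReal (C₃ * l ^ 3 * r ^ 2) := by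
          refine ENNReal.ofReal_le_ofReal ?_
          have h1 : (s m) ^ 2 ≤ (θ ^ 2)⁻¹ * r ^ 2 := by
            have : (s m) ^ 2 < (r / θ) ^ 2 := by gcongr
            rw [div_pow] at this
            rw [inv_mul_eq_div]
            exact this.le
          have h2 : (Ac + Md) * (θ ^ 2)⁻¹ ≤ C₃ := le_max_right _ _
          calc (s m) ^ 2 * ((Ac + Md) * l ^ 3) ≤ (θ ^ 2)⁻¹ * r ^ 2 * ((Ac + Md) * l ^ 3) :=
                mul_le_mul_of_nonneg_right h1 (by positivity)
            _ = (Ac + Md) * (θ ^ 2)⁻¹ * l ^ 3 * r ^ 2 := by ring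
            _ ≤ C₃ * l ^ 3 * r ^ 2 := by gcongr

end Setting

/-- **Lemma 14.2 at `ν = 1`, `r₀ = 1`** (Lemarié-Rieusset, Lemma 14.2 with the printed proof of
pp. 505–507, in the tree's scaled vocabulary): for `q ≥ 5/3` there are `ε₁, C₃ > 0` (depending
only on `q`) such that for every `(Ω, f, u, p, G)` satisfying the §14.3 hypotheses with `ν = 1`,
every unit cylinder `Q_1(z₀) ⊆ Ω` and `0 ≤ λ ≤ ε₁` with
`∫∫_{Q_1(z₀)} (|u|³ + |p|^{3/2}) ≤ λ³`, `∫∫_{Q_1(z₀)} |f|^q ≤ λ^{2q}`: for all `z ∈ Q_{3/4}(z₀)` and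
`0 < r ≤ 1/8`, `∫∫_{Q_r(z)} (|u|³ + |p|^{3/2}) ≤ C₃ λ³ r²`. [cite: Lemarierieusset2023, §14.3 Lemma 14.2 (scan pp. 507–508)] -/
theorem lemma_14_2_unit_nu_one {q : ℝ} (hq : 5 / 3 ≤ q) :
    ∃ ε₁ C₃ : ℝ, 0 < ε₁ ∧ 0 < C₃ ∧
      ∀ (Ω : Opens (ℝ × ℝ³)) (f u : ℝ → ℝ³ → ℝ³) (p : ℝ → ℝ³ → ℝ) (G : ℝ → ℝ³ → ℝ³ →L[ℝ] ℝ³),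
        IsLRSuitableWeakSolutionOn Ω 1 q f u p G →
        ∀ (z₀ : ℝ × ℝ³) (l : ℝ), parabolicCylinder 1 z₀ ⊆ (Ω : Set (ℝ × ℝ³)) → 0 ≤ l → l ≤ ε₁ →
          ∫⁻ w in parabolicCylinder 1 z₀,
              (‖u w.1 w.2‖ₑ ^ (3 : ℕ) + ‖p w.1 w.2‖ₑ ^ (3 / 2 : ℝ)) ≤ ENNReal.ofReal (l ^ 3) →
          ∫⁻ w in parabolicCylinder 1 z₀, ‖f w.1 w.2‖ₑ ^ q ≤ ENNReal.ofReal (l ^ (2 * q)) →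
          ∀ z ∈ parabolicCylinder (3 / 4) z₀, ∀ r : ℝ, 0 < r → r ≤ 1 / 8 →
            ∫⁻ w in parabolicCylinder r z,
                (‖u w.1 w.2‖ₑ ^ (3 : ℕ) + ‖p w.1 w.2‖ₑ ^ (3 / 2 : ℝ)) ≤
              ENNReal.ofReal (C₃ * l ^ 3 * r ^ 2) := by
  have hq32 : 3 / 2 ≤ q := by linarith
  -- ### the constants
  obtain ⟨c₁, c₂, c₃, c₄, hLE⟩ := localEnergyBound one_pos
  obtain ⟨C₀, hC₀⟩ := exists_cknC_le_rpow
  obtain ⟨κ₅, κ₆, κ₇, hPE⟩ := pressureEstimate_force hq32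
  obtain ⟨My, hMy⟩ : ∃ My : ℝ, My = 4 * c₁ + 256 * c₂ + 256 * c₃ + 8 * c₄ + 1 := ⟨_, rfl⟩
  have hMyb : (4 * c₁ + 256 * c₂ + 256 * c₃ + 8 * c₄ : ℝ) ≤ My := by rw [hMy]; linarith
  have hMy0 : 0 < My := by
    have : (0 : ℝ) ≤ 4 * c₁ + 256 * c₂ + 256 * c₃ + 8 * c₄ := by positivity
    linarith
  obtain ⟨Ac, hAc⟩ : ∃ Ac : ℝ, Ac = C₀ * My ^ (3 / 2 : ℝ) := ⟨_, rfl⟩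
  have hAc0 : 0 ≤ Ac := by rw [hAc]; positivity
  obtain ⟨X, hX⟩ : ∃ X : ℝ, X = c₁ * Ac ^ (2 / 3 : ℝ) := ⟨_, rfl⟩
  have hX0 : 0 ≤ X := by rw [hX]; positivity
  obtain ⟨T₁, hT₁⟩ : ∃ T₁ : ℝ, T₁ = My / (4 * (X + 1)) := ⟨_, rfl⟩
  obtain ⟨T₂, hT₂⟩ : ∃ T₂ : ℝ, T₂ = 1 / (4 * (κ₆ + 1)) := ⟨_, rfl⟩
  have hT₁0 : 0 < T₁ := by rw [hT₁]; positivity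
  have hT₂0 : 0 < T₂ := by rw [hT₂]; positivity
  obtain ⟨θ, hθdef⟩ : ∃ θ : ℝ, θ = min (1 / 2) (min T₁ T₂) := ⟨_, rfl⟩
  have hθ0 : 0 < θ := by rw [hθdef]; exact lt_min (by norm_num) (lt_min hT₁0 hT₂0)
  have hθ2 : θ ≤ 1 / 2 := by rw [hθdef]; exact min_le_left _ _
  have hθ1 : θ < 1 := by linarith
  have hθT₁ : θ ≤ T₁ := by rw [hθdef]; exact (min_le_right _ _).trans (min_le_left _ _)
  have hθT₂ : θ ≤ T₂ := by rw [hθdef]; exact (min_le_right _ _).trans (min_le_right _ _)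
  -- `c₁ Ac^{2/3} θ² ≤ My/4` and `κ₆ θ ≤ 1/4`
  have hcontr₁ : c₁ * θ ^ 2 * Ac ^ (2 / 3 : ℝ) ≤ My / 4 := by
    have h1 : θ ^ 2 ≤ θ := by nlinarith
    have h2 : X * θ ≤ X * T₁ := mul_le_mul_of_nonneg_left hθT₁ hX0
    have hX1 : X / (X + 1) ≤ 1 := (div_le_one (by positivity)).2 (by linarith)
    have h3 : X * T₁ ≤ My / 4 := by
      calc X * T₁ = X / (X + 1) * (My / 4) := by
            rw [hT₁]
            field_simp
        _ ≤ 1 * (My / 4) := mul_le_mul_of_nonneg_right hX1 (by positivity)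
        _ = My / 4 := one_mul _
    calc c₁ * θ ^ 2 * Ac ^ (2 / 3 : ℝ) = X * θ ^ 2 := by rw [hX]; ring
      _ ≤ X * θ := mul_le_mul_of_nonneg_left h1 hX0
      _ ≤ My / 4 := h2.trans h3
  have hcontr₂ : κ₆ * θ ≤ 1 / 4 := by
    have h1 : (κ₆ : ℝ) * T₂ ≤ 1 / 4 := by
      rw [hT₂, mul_one_div, div_le_div_iff₀ (by positivity) (by norm_num)]
      nlinarith [NNReal.coe_nonneg κ₆]
    exact (mul_le_mul_of_nonneg_left hθT₂ (NNReal.coe_nonneg κ₆)).trans h1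
  obtain ⟨Md, hMd⟩ : ∃ Md : ℝ,
      Md = 256 + 2 * (κ₅ * θ ^ (-(3 / 2 : ℝ)) * My ^ (3 / 2 : ℝ) + 4 * κ₇ * (θ ^ 2)⁻¹) := ⟨_, rfl⟩
  have hZ0 : 0 ≤ κ₅ * θ ^ (-(3 / 2 : ℝ)) * My ^ (3 / 2 : ℝ) + 4 * κ₇ * (θ ^ 2)⁻¹ := by positivity
  have hMd256 : 256 ≤ Md := by rw [hMd]; linarith
  have hMd0 : 0 ≤ Md := by linarith
  obtain ⟨P, hP⟩ : ∃ P : ℝ, P = c₂ * (θ ^ 2)⁻¹ * Ac + c₃ * (θ ^ 2)⁻¹ * Md ^ (2 / 3 : ℝ) *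
      Ac ^ (1 / 3 : ℝ) + c₄ * θ⁻¹ * Ac ^ (1 / 3 : ℝ) := ⟨_, rfl⟩
  have hP0 : 0 ≤ P := by rw [hP]; positivity
  obtain ⟨ε₁, hε₁⟩ : ∃ ε₁ : ℝ, ε₁ = min 1 (3 * My / 4 / (P + 1)) := ⟨_, rfl⟩
  have hε₁0 : 0 < ε₁ := by rw [hε₁]; exact lt_min one_pos (by positivity)
  obtain ⟨C₃, hC₃⟩ : ∃ C₃ : ℝ, C₃ = max 256 ((C₀ * My ^ (3 / 2 : ℝ) + Md) * (θ ^ 2)⁻¹) := ⟨_, rfl⟩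
  have hC₃0 : 0 < C₃ := by rw [hC₃]; exact lt_of_lt_of_le (by norm_num) (le_max_left _ _)
  refine ⟨ε₁, C₃, hε₁0, hC₃0, ?_⟩
  intro Ω f u p G hS z₀ l hsub hl hlε hUP hF z hz r hr hr8
  have hl1 : l ≤ 1 := hlε.trans (by rw [hε₁]; exact min_le_left _ _)
  have hlP : l * P ≤ 3 * My / 4 := by
    have h1 : l ≤ 3 * My / 4 / (P + 1) := hlε.trans (by rw [hε₁]; exact min_le_right _ _)
    calc l * P ≤ l * (P + 1) := by nlinarith
      _ ≤ 3 * My / 4 / (P + 1) * (P + 1) := mul_le_mul_of_nonneg_right h1 (by positivity)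
      _ = 3 * My / 4 := by field_simp
  -- the two algebraic conditions of the steps
  have halgY : c₁ * θ ^ 2 * (C₀ * My ^ (3 / 2 : ℝ)) ^ (2 / 3 : ℝ) +
      l * (c₂ * (θ ^ 2)⁻¹ * (C₀ * My ^ (3 / 2 : ℝ)) +
        c₃ * (θ ^ 2)⁻¹ * Md ^ (2 / 3 : ℝ) * (C₀ * My ^ (3 / 2 : ℝ)) ^ (1 / 3 : ℝ) +
        c₄ * θ⁻¹ * (C₀ * My ^ (3 / 2 : ℝ)) ^ (1 / 3 : ℝ)) ≤ My := by
    rw [← hAc, ← hP]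
    linarith
  have halgD : κ₅ * θ ^ (-(3 / 2 : ℝ)) * My ^ (3 / 2 : ℝ) + 4 * κ₇ * (θ ^ 2)⁻¹ + κ₆ * θ * Md ≤ Md := by
    have h1 : κ₆ * θ * Md ≤ 1 / 4 * Md := mul_le_mul_of_nonneg_right hcontr₂ hMd0
    rw [hMd] at h1 ⊢
    linarith
  -- the state along the scales
  have hstate : ∀ n : ℕ, cknAEss (θ ^ n * (1 / 16)) z u + cknE (θ ^ n * (1 / 16)) z G ≤
      ENNReal.ofReal (My * l ^ 2) ∧ cknD (θ ^ n * (1 / 16)) z p ≤ ENNReal.ofReal (Md * l ^ 3) := by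
    intro n
    induction n with
    | zero =>
      rw [pow_zero, one_mul]
      obtain ⟨hY0, hD0⟩ := core_base hq hS hsub hl hUP hF hz hLE hl1
      constructor
      · refine hY0.trans (ENNReal.ofReal_le_ofReal ?_)
        exact mul_le_mul_of_nonneg_right hMyb (pow_nonneg hl 2)
      · refine hD0.trans (ENNReal.ofReal_le_ofReal ?_)
        exact mul_le_mul_of_nonneg_right hMd256 (pow_nonneg hl 3)
    | succ n ih =>
      obtain ⟨ihY, ihD⟩ := ih
      have hsn : 0 < θ ^ n * (1 / 16) := by positivity
      have hsn16 : θ ^ n * (1 / 16) ≤ 1 / 16 := by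
        have : θ ^ n ≤ 1 := pow_le_one₀ hθ0.le hθ1.le
        calc θ ^ n * (1 / 16) ≤ 1 * (1 / 16) := by gcongr
          _ = 1 / 16 := one_mul _
      have e : θ ^ (n + 1) * (1 / 16) = θ * (θ ^ n * (1 / 16)) := by rw [pow_succ]; ring
      rw [e]
      exact ⟨core_stepY hq hS hsub hl hF hz hLE hC₀ hθ0 hθ2 hMy0.le hMd0 halgY hsn
          (hsn16.trans (by norm_num)) ihY ihD,
        core_stepD hq hS hsub hl hUP hF hz hPE hθ0 hθ2 hMy0.le hMd0 halgD hsn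
          (hsn16.trans (by norm_num)) ihY ihD⟩
  rw [hC₃]
  exact core_final hS hsub hl hUP hz hC₀ hθ0 hθ1 hMy0.le hMd0 hstate hr hr8

end Core

/-! ### Lemma 14.2 at `ν = 1`, all scales and centres -/

/-- `(r²)^{3/2} = r³` for `r ≥ 0`. [folklore] -/
theorem sq_rpow_three_halves {r : ℝ} (hr : 0 ≤ r) : (r ^ 2) ^ (3 / 2 : ℝ) = r ^ 3 := by
  rw [← Real.rpow_natCast r 2, ← Real.rpow_mul hr, ← Real.rpow_natCast r 3]
  norm_num

/-- **Lemma 14.2 at `ν = 1`** (all centres `z₀` and radii `r₀`) from the unit-scale case, by the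
Navier–Stokes scaling `w = r₀ u ∘ Φ`, `π = r₀² p ∘ Φ`, `g = r₀³ f ∘ Φ`,
`Φ(s, y) = (t₀ + r₀² s, x₀ + r₀ y)` — the computation of the accepted
`lemarieRieusset_lemma_14_2_of_unitScale` at the fixed viscosity `1`
(`IsLRSuitableWeakSolutionOn.nsRescale`). [cite: Lemarierieusset2023, §14.3 Lemma 14.2 (scan pp. 507–508)] -/
theorem lemma_14_2_nu_one {q : ℝ} (hq : 5 / 3 ≤ q) :
    ∃ ε₁ C₃ : ℝ, 0 < ε₁ ∧ 0 < C₃ ∧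
      ∀ (Ω : Opens (ℝ × ℝ³)) (f u : ℝ → ℝ³ → ℝ³) (p : ℝ → ℝ³ → ℝ) (G : ℝ → ℝ³ → ℝ³ →L[ℝ] ℝ³),
        IsLRSuitableWeakSolutionOn Ω 1 q f u p G →
        ∀ (z₀ : ℝ × ℝ³) (r₀ l : ℝ), 0 < r₀ →
          parabolicCylinder r₀ z₀ ⊆ (Ω : Set (ℝ × ℝ³)) → 0 ≤ l → l ≤ ε₁ →
          ∫⁻ w in parabolicCylinder r₀ z₀,
              (‖u w.1 w.2‖ₑ ^ (3 : ℕ) + ‖p w.1 w.2‖ₑ ^ (3 / 2 : ℝ)) ≤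
            ENNReal.ofReal (l ^ 3 * r₀ ^ 2) →
          ∫⁻ w in parabolicCylinder r₀ z₀, ‖f w.1 w.2‖ₑ ^ q ≤
            ENNReal.ofReal (l ^ (2 * q) * r₀ ^ (5 - 3 * q)) →
          ∀ z ∈ parabolicCylinder (3 * r₀ / 4) z₀, ∀ r : ℝ, 0 < r → r ≤ r₀ / 8 →
            ∫⁻ w in parabolicCylinder r z,
                (‖u w.1 w.2‖ₑ ^ (3 : ℕ) + ‖p w.1 w.2‖ₑ ^ (3 / 2 : ℝ)) ≤
              ENNReal.ofReal (C₃ * l ^ 3 * r ^ 2) := by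
  obtain ⟨ε₁, C₃, hε₁, hC₃, H⟩ := lemma_14_2_unit_nu_one hq
  refine ⟨ε₁, C₃, hε₁, hC₃, fun Q f u p G hS z₀ r₀ l hr₀ hsub hl hlε hUP hF z hz r hr hrr₀ => ?_⟩
  have hq0 : 0 < q := by linarith
  have hβ0 : (0 : ℝ) < r₀ ^ 2 := by positivity
  -- the rescaled datum
  have hS' := hS.nsRescale hr₀ z₀.1 z₀.2
  set Φ := stAffine (r₀ ^ 2) r₀ z₀.1 z₀.2 with hΦ
  have hpre : ∀ ρ : ℝ, Φ ⁻¹' parabolicCylinder ρ z₀ = parabolicCylinder (ρ / r₀) (0 : ℝ × ℝ³) :=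
    fun ρ => stAffine_sq_preimage_parabolicCylinder hr₀ z₀ ρ
  have hpre1 : Φ ⁻¹' parabolicCylinder r₀ z₀ = parabolicCylinder 1 (0 : ℝ × ℝ³) := by
    rw [hpre, div_self hr₀.ne']
  have h1 : parabolicCylinder 1 (0 : ℝ × ℝ³) ⊆
      ((stPreimage (r₀ ^ 2) r₀ z₀.1 z₀.2 Q : Opens (ℝ × ℝ³)) : Set (ℝ × ℝ³)) := by
    rw [coe_stPreimage, ← hpre1]
    exact preimage_mono hsub
  have hJ : ENNReal.ofReal (r₀ ^ 2 * r₀ ^ Module.finrank ℝ ℝ³)⁻¹ =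
      ENNReal.ofReal (r₀ ^ 5)⁻¹ := by
    rw [finrank_euclideanSpace_three]
    congr 1
    ring
  -- the pulled-back integrand is `r₀³` times the integrand at `Φ w`, on every set
  set Fs : ℝ × ℝ³ → ℝ≥0∞ := fun z => ‖u z.1 z.2‖ₑ ^ (3 : ℕ) + ‖p z.1 z.2‖ₑ ^ (3 / 2 : ℝ)
    with hFs
  have hpt : ∀ w : ℝ × ℝ³,
      ‖(r₀ • stPull (r₀ ^ 2) r₀ z₀.1 z₀.2 u) w.1 w.2‖ₑ ^ (3 : ℕ) +
        ‖(r₀ ^ 2 • stPull (r₀ ^ 2) r₀ z₀.1 z₀.2 p) w.1 w.2‖ₑ ^ (3 / 2 : ℝ) =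
      ENNReal.ofReal (r₀ ^ 3) * Fs (Φ w) := by
    intro w
    rw [smul_stPull_apply, smul_stPull_apply, enorm_smul, enorm_smul, mul_pow,
      ENNReal.mul_rpow_of_nonneg _ _ (by norm_num), Real.enorm_eq_ofReal hr₀.le,
      Real.enorm_eq_ofReal hβ0.le, ← ENNReal.ofReal_pow hr₀.le,
      ENNReal.ofReal_rpow_of_nonneg hβ0.le (by norm_num), sq_rpow_three_halves hr₀.le, hFs,
      mul_add]
    rfl
  have hscale : ∀ (S : Set (ℝ × ℝ³)),
      ∫⁻ w in Φ ⁻¹' S, (‖(r₀ • stPull (r₀ ^ 2) r₀ z₀.1 z₀.2 u) w.1 w.2‖ₑ ^ (3 : ℕ) +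
        ‖(r₀ ^ 2 • stPull (r₀ ^ 2) r₀ z₀.1 z₀.2 p) w.1 w.2‖ₑ ^ (3 / 2 : ℝ)) =
      ENNReal.ofReal (r₀ ^ 3) * (ENNReal.ofReal (r₀ ^ 5)⁻¹ * ∫⁻ z in S, Fs z) := by
    intro S
    simp_rw [hpt]
    rw [lintegral_const_mul' _ _ ENNReal.ofReal_ne_top,
      setLIntegral_preimage_comp_stAffine hβ0 hr₀ z₀.1 z₀.2 Fs, hJ]
  -- smallness of `(w, π)` and of `g` on `Q₁(0,0)`
  have h2 : ∫⁻ w in parabolicCylinder 1 (0 : ℝ × ℝ³),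
      (‖(r₀ • stPull (r₀ ^ 2) r₀ z₀.1 z₀.2 u) w.1 w.2‖ₑ ^ (3 : ℕ) +
        ‖(r₀ ^ 2 • stPull (r₀ ^ 2) r₀ z₀.1 z₀.2 p) w.1 w.2‖ₑ ^ (3 / 2 : ℝ)) ≤
      ENNReal.ofReal (l ^ 3) := by
    rw [← hpre1, hscale]
    calc ENNReal.ofReal (r₀ ^ 3) *
          (ENNReal.ofReal (r₀ ^ 5)⁻¹ * ∫⁻ z in parabolicCylinder r₀ z₀, Fs z)
        ≤ ENNReal.ofReal (r₀ ^ 3) *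
            (ENNReal.ofReal (r₀ ^ 5)⁻¹ * ENNReal.ofReal (l ^ 3 * r₀ ^ 2)) := by
          gcongr
      _ = ENNReal.ofReal (l ^ 3) := by
          rw [← ENNReal.ofReal_mul (by positivity), ← ENNReal.ofReal_mul (by positivity)]
          congr 1
          field_simp
  have h3 : ∫⁻ w in parabolicCylinder 1 (0 : ℝ × ℝ³),
      ‖((r₀ ^ 2 * r₀) • stPull (r₀ ^ 2) r₀ z₀.1 z₀.2 f) w.1 w.2‖ₑ ^ q ≤
      ENNReal.ofReal (l ^ (2 * q)) := by
    rw [← hpre1, setLIntegral_enorm_rpow_stRescale hβ0 hr₀ z₀.1 z₀.2 (r₀ ^ 2 * r₀) f _ hq0.le,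
      hJ, Real.enorm_eq_ofReal (by positivity),
      ENNReal.ofReal_rpow_of_nonneg (by positivity) hq0.le]
    calc ENNReal.ofReal ((r₀ ^ 2 * r₀) ^ q) * ENNReal.ofReal (r₀ ^ 5)⁻¹ *
          ∫⁻ z in parabolicCylinder r₀ z₀, ‖f z.1 z.2‖ₑ ^ q
        ≤ ENNReal.ofReal ((r₀ ^ 2 * r₀) ^ q) * ENNReal.ofReal (r₀ ^ 5)⁻¹ *
            ENNReal.ofReal (l ^ (2 * q) * r₀ ^ (5 - 3 * q)) := by
          gcongr
      _ = ENNReal.ofReal (l ^ (2 * q)) := by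
          rw [← ENNReal.ofReal_mul (by positivity), ← ENNReal.ofReal_mul (by positivity)]
          congr 1
          have e1 : (r₀ ^ 2 * r₀) ^ q = r₀ ^ (3 * q) := by
            rw [show r₀ ^ 2 * r₀ = r₀ ^ (3 : ℕ) by ring, ← Real.rpow_natCast r₀ 3,
              ← Real.rpow_mul hr₀.le]
            norm_num
          have e2 : r₀ ^ (5 - 3 * q) = r₀ ^ (5 : ℕ) / r₀ ^ (3 * q) := by
            rw [Real.rpow_sub hr₀, Real.rpow_ofNat]
          have e3 : 0 < r₀ ^ (3 * q) := Real.rpow_pos_of_pos hr₀ _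
          rw [e1, e2]
          field_simp
  -- the point `Φ⁻¹ z ∈ Q_{3/4}(0,0)` and the scale `r/r₀ ≤ 1/8`
  set z' : ℝ × ℝ³ := ((z.1 - z₀.1) / r₀ ^ 2, r₀⁻¹ • (z.2 - z₀.2)) with hz'
  have hΦz' : Φ z' = z := stAffine_sq_apply_symm hr₀ z₀ z
  have hz'mem : z' ∈ parabolicCylinder (3 / 4) (0 : ℝ × ℝ³) := by
    have e : (3 : ℝ) / 4 = 3 * r₀ / 4 / r₀ := by field_simp
    rw [e, ← hpre, mem_preimage, hΦz']
    exact hz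
  have hr' : 0 < r / r₀ := by positivity
  have hr'' : r / r₀ ≤ 1 / 8 := by
    rw [div_le_iff₀ hr₀]
    linarith
  -- apply the unit-scale statement at `(z', r/r₀)` and scale back
  have key := H _ _ _ _ _ hS' 0 l h1 hl hlε h2 h3 z' hz'mem (r / r₀) hr' hr''
  rw [← stAffine_sq_preimage_parabolicCylinder' hr₀ z₀ z r, hscale, ← mul_assoc] at key
  -- `key : (r₀³ · r₀⁻⁵) · ∫∫_{Q_r(z)} Fs ≤ C₃ λ³ (r/r₀)²`
  have hA0 : ENNReal.ofReal (r₀ ^ 3) * ENNReal.ofReal (r₀ ^ 5)⁻¹ ≠ 0 := by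
    refine mul_ne_zero ?_ ?_ <;> exact (ENNReal.ofReal_pos.2 (by positivity)).ne'
  have hAtop : ENNReal.ofReal (r₀ ^ 3) * ENNReal.ofReal (r₀ ^ 5)⁻¹ ≠ ∞ :=
    ENNReal.mul_ne_top ENNReal.ofReal_ne_top ENNReal.ofReal_ne_top
  have key2 : ∫⁻ z in parabolicCylinder r z, Fs z ≤
      ENNReal.ofReal (C₃ * l ^ 3 * (r / r₀) ^ 2) /
        (ENNReal.ofReal (r₀ ^ 3) * ENNReal.ofReal (r₀ ^ 5)⁻¹) := by
    rw [ENNReal.le_div_iff_mul_le (Or.inl hA0) (Or.inl hAtop), mul_comm]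
    exact key
  refine key2.trans (le_of_eq ?_)
  rw [← ENNReal.ofReal_mul (by positivity), ← ENNReal.ofReal_div_of_pos (by positivity)]
  congr 1
  field_simp

/-! ### From `ν = 1` to every viscosity: the covering argument -/

section Viscosity

/-- **Covering a stretched cylinder.** For `ν > 0`, `r > 0`, the set
`(t' - ν r², t') × B(x', r)` is covered by the `⌈2ν⌉ + 1` backward cylinders
`Q_r(t' - k r²/2, x')`, `k = 0, …, ⌈2ν⌉`. [folklore] -/
theorem stretched_subset_iUnion {ν r : ℝ} (hν : 0 < ν) (hr : 0 < r) (t' : ℝ) (x' : ℝ³) :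
    Ioo (t' - ν * r ^ 2) t' ×ˢ ball x' r ⊆
      ⋃ k : Fin (⌈2 * ν⌉₊ + 1), parabolicCylinder r (t' - k * r ^ 2 / 2, x') := by
  rintro ⟨τ, y⟩ ⟨⟨hτ1, hτ2⟩, hy⟩
  have hr2 : 0 < r ^ 2 := by positivity
  set μ : ℝ := 2 * (t' - τ) / r ^ 2 with hμ
  have hμ0 : 0 < μ := by rw [hμ]; exact div_pos (by linarith) hr2
  have hμν : μ ≤ 2 * ν := by
    rw [hμ, div_le_iff₀ hr2]
    nlinarith
  have hceil1 : 1 ≤ ⌈μ⌉₊ := Nat.lt_ceil.2 (by simpa using hμ0)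
  set k : ℕ := ⌈μ⌉₊ - 1 with hk
  have hkμ : (k : ℝ) < μ := by
    rw [hk, Nat.cast_sub hceil1, Nat.cast_one]
    linarith [Nat.ceil_lt_add_one hμ0.le]
  have hμk : μ ≤ k + 1 := by
    rw [hk, Nat.cast_sub hceil1, Nat.cast_one, sub_add_cancel]
    exact Nat.le_ceil μ
  have hkN : k < ⌈2 * ν⌉₊ + 1 := by
    have : ⌈μ⌉₊ ≤ ⌈2 * ν⌉₊ := Nat.ceil_mono hμν
    omega
  refine mem_iUnion.2 ⟨⟨k, hkN⟩, ?_⟩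
  rw [mem_parabolicCylinder]
  refine ⟨⟨?_, ?_⟩, hy⟩
  · -- `τ > t' - k r²/2 - r²`
    dsimp only
    have h1 : t' - τ = μ * r ^ 2 / 2 := by rw [hμ]; field_simp
    nlinarith
  · -- `τ < t' - k r²/2`
    dsimp only
    have h1 : t' - τ = μ * r ^ 2 / 2 := by rw [hμ]; field_simp
    nlinarith

/-- A finite sum bound for the integral over a covered set. [folklore] -/
theorem lintegral_le_card_mul_of_subset_iUnion {N : ℕ} {S : Set (ℝ × ℝ³)}
    {T : Fin N → Set (ℝ × ℝ³)} (hS : S ⊆ ⋃ k, T k) (F : ℝ × ℝ³ → ℝ≥0∞) {B : ℝ≥0∞}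
    (hB : ∀ k, ∫⁻ w in T k, F w ≤ B) : ∫⁻ w in S, F w ≤ N * B := by
  calc ∫⁻ w in S, F w ≤ ∫⁻ w in ⋃ k, T k, F w := lintegral_mono_set hS
    _ ≤ ∑' k, ∫⁻ w in T k, F w := lintegral_iUnion_le _ _
    _ = ∑ k, ∫⁻ w in T k, F w := tsum_fintype _
    _ ≤ ∑ _k : Fin N, B := Finset.sum_le_sum fun k _ => hB k
    _ = N * B := by
        rw [Finset.sum_const, Finset.card_univ, Fintype.card_fin, nsmul_eq_mul]

/-- **The admissible base cylinder.** In the normalised picture (`S₀ = (-ν r₀², 0) × B(0, r₀)`,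
`c = min(1/2, √ν/2)`, `ρ = c r₀`): for a centre `(t', x')` with `-ν (3r₀/4)² < t' < 0`,
`‖x'‖ < 3r₀/4`, a radius `0 < r ≤ c r₀ / 8` and a shift `0 ≤ k ≤ 2ν + 1`, the shifted centre
`(t' - k r²/2, x')` lies in `Q_{3ρ/4}(w)` for a cylinder `Q_ρ(w) ⊆ S₀`. [folklore] -/
theorem exists_base_center {ν r₀ r k t' : ℝ} {x' : ℝ³} (hν : 0 < ν) (hr₀ : 0 < r₀) (hr : 0 < r)
    (hrc : r ≤ min (1 / 2) (Real.sqrt ν / 2) * r₀ / 8) (hk0 : 0 ≤ k) (hk : k ≤ 2 * ν + 1)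
    (ht'1 : -(ν * (3 * r₀ / 4) ^ 2) < t') (ht'2 : t' < 0) (hx' : ‖x'‖ < 3 * r₀ / 4) :
    ∃ w : ℝ × ℝ³, (t' - k * r ^ 2 / 2, x') ∈
        parabolicCylinder (3 * (min (1 / 2) (Real.sqrt ν / 2) * r₀) / 4) w ∧
      parabolicCylinder (min (1 / 2) (Real.sqrt ν / 2) * r₀) w ⊆
        Ioo (-(ν * r₀ ^ 2)) 0 ×ˢ ball (0 : ℝ³) r₀ := by
  set c : ℝ := min (1 / 2) (Real.sqrt ν / 2) with hc
  have hc0 : 0 < c := lt_min (by norm_num) (by positivity)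
  have hc12 : c ≤ 1 / 2 := min_le_left _ _
  have hc1 : c ≤ 1 := by linarith
  have hcν : c ^ 2 ≤ ν / 4 := by
    have h1 : c ≤ Real.sqrt ν / 2 := min_le_right _ _
    have h2 : c ^ 2 ≤ (Real.sqrt ν / 2) ^ 2 := pow_le_pow_left₀ hc0.le h1 2
    rw [div_pow, Real.sq_sqrt hν.le] at h2
    linarith
  have hc4 : c ^ 2 ≤ 1 / 4 := by nlinarith
  set ρ : ℝ := c * r₀ with hρ
  have hρ0 : 0 < ρ := by positivity
  have hr2 : r ^ 2 ≤ c ^ 2 * r₀ ^ 2 / 64 := by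
    have h1 : r ≤ c * r₀ / 8 := hrc
    have h2 : r ^ 2 ≤ (c * r₀ / 8) ^ 2 := pow_le_pow_left₀ hr.le h1 2
    nlinarith
  -- the products needed below, as linear facts
  have hνr₀ : 0 ≤ ν * r₀ ^ 2 := by positivity
  have p1 : ν * (c ^ 2 * r₀ ^ 2) ≤ ν * (1 / 4 * r₀ ^ 2) :=
    mul_le_mul_of_nonneg_left (mul_le_mul_of_nonneg_right hc4 (sq_nonneg _)) hν.le
  have p2 : c ^ 2 * r₀ ^ 2 ≤ ν / 4 * r₀ ^ 2 := mul_le_mul_of_nonneg_right hcν (sq_nonneg _)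
  have p3 : k * r ^ 2 ≤ (2 * ν + 1) * (c ^ 2 * r₀ ^ 2 / 64) :=
    mul_le_mul hk hr2 (sq_nonneg _) (by positivity)
  have hkr : k * r ^ 2 ≤ 3 * ν * r₀ ^ 2 / 256 := by nlinarith
  set tk : ℝ := t' - k * r ^ 2 / 2 with htk
  refine ⟨(min 0 (tk + ρ ^ 2 / 2), (1 - c) • x'), ?_, ?_⟩
  · rw [mem_parabolicCylinder]
    refine ⟨⟨?_, ?_⟩, ?_⟩
    · dsimp only
      have h1 : min 0 (tk + ρ ^ 2 / 2) ≤ tk + ρ ^ 2 / 2 := min_le_right _ _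
      nlinarith
    · dsimp only
      refine lt_min (by rw [htk]; nlinarith) (by nlinarith)
    · dsimp only
      rw [dist_eq_norm, show x' - (1 - c) • x' = c • x' by rw [sub_smul, one_smul, sub_sub_cancel],
        norm_smul, Real.norm_eq_abs, abs_of_pos hc0, hρ]
      nlinarith
  · rintro ⟨τ, y⟩ hτy
    rw [mem_parabolicCylinder] at hτy
    obtain ⟨⟨hτ1, hτ2⟩, hy⟩ := hτy
    dsimp only at hτ1 hτ2 hy
    refine ⟨⟨?_, lt_of_lt_of_le hτ2 (min_le_left _ _)⟩, ?_⟩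
    · -- `τ > -ν r₀²`
      have hρ2 : ρ ^ 2 = c ^ 2 * r₀ ^ 2 := by rw [hρ]; ring
      have h2 : -(ν * r₀ ^ 2) ≤ min 0 (tk + ρ ^ 2 / 2) - ρ ^ 2 := by
        rw [le_sub_iff_add_le, le_min_iff]
        constructor
        · nlinarith
        · rw [htk, hρ2]; nlinarith
      linarith
    · rw [mem_ball, dist_zero_right]
      have h1 : ‖(1 - c) • x'‖ = (1 - c) * ‖x'‖ := by
        rw [norm_smul, Real.norm_eq_abs, abs_of_nonneg (by linarith)]
      calc ‖y‖ ≤ ‖y - (1 - c) • x'‖ + ‖(1 - c) • x'‖ := norm_le_norm_sub_add _ _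
        _ < ρ + (1 - c) * ‖x'‖ := by
            rw [← dist_eq_norm, h1]; exact add_lt_add_of_lt_of_le hy le_rfl
        _ ≤ c * r₀ + (1 - c) * (3 * r₀ / 4) := by
            rw [hρ]; exact add_le_add le_rfl (mul_le_mul_of_nonneg_left hx'.le (by linarith))
        _ ≤ r₀ := by nlinarith

/-- **The constant of the smallness transfer.** For `ν > 0`, `q > 0`, `0 < c ≤ 1`,
`K = max(1, (ν²c²)^{-1/3}, ((ν⁻²)^q ν)^{1/(2q)})` satisfies `ν⁻² ≤ K³ c²` and
`(ν⁻¹)^{2q}·ν ≤ K^{2q} c^{5-3q}` when `5 - 3q ≤ 0`. [folklore] -/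
theorem transfer_constants {ν q c : ℝ} (hν : 0 < ν) (hq : 5 / 3 ≤ q) (hc0 : 0 < c) (hc1 : c ≤ 1) :
    ∃ K : ℝ, 1 ≤ K ∧ (ν ^ 2)⁻¹ ≤ K ^ 3 * c ^ 2 ∧
      (ν⁻¹ ^ 2) ^ q * ν ≤ K ^ (2 * q) * c ^ (5 - 3 * q) := by
  have hq0 : 0 < q := by linarith
  set K₁ : ℝ := ((ν ^ 2 * c ^ 2)⁻¹) ^ (1 / 3 : ℝ) with hK₁
  set K₂ : ℝ := ((ν⁻¹ ^ 2) ^ q * ν) ^ (1 / (2 * q)) with hK₂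
  have hK₁0 : 0 ≤ K₁ := Real.rpow_nonneg (by positivity) _
  have hK₂0 : 0 ≤ K₂ := Real.rpow_nonneg (by positivity) _
  refine ⟨max 1 (max K₁ K₂), le_max_left _ _, ?_, ?_⟩
  · have h1 : K₁ ≤ max 1 (max K₁ K₂) := (le_max_left _ _).trans (le_max_right _ _)
    have h2 : K₁ ^ 3 ≤ (max 1 (max K₁ K₂)) ^ 3 := pow_le_pow_left₀ hK₁0 h1 3
    have h3 : K₁ ^ 3 = (ν ^ 2 * c ^ 2)⁻¹ := by
      rw [hK₁, ← Real.rpow_natCast, ← Real.rpow_mul (by positivity)]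
      norm_num
    have hc2 : 0 < c ^ 2 := by positivity
    calc (ν ^ 2)⁻¹ = (ν ^ 2 * c ^ 2)⁻¹ * c ^ 2 := by field_simp
      _ = K₁ ^ 3 * c ^ 2 := by rw [h3]
      _ ≤ (max 1 (max K₁ K₂)) ^ 3 * c ^ 2 := mul_le_mul_of_nonneg_right h2 hc2.le
  · have h1 : K₂ ≤ max 1 (max K₁ K₂) := (le_max_right _ _).trans (le_max_right _ _)
    have h2 : K₂ ^ (2 * q) ≤ (max 1 (max K₁ K₂)) ^ (2 * q) :=
      Real.rpow_le_rpow hK₂0 h1 (by positivity)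
    have h3 : K₂ ^ (2 * q) = (ν⁻¹ ^ 2) ^ q * ν := by
      rw [hK₂, ← Real.rpow_mul (by positivity), one_div_mul_cancel (by positivity), Real.rpow_one]
    have h4 : 1 ≤ c ^ (5 - 3 * q) :=
      Real.one_le_rpow_of_pos_of_le_one_of_nonpos hc0 hc1 (by linarith)
    have h5 : 0 ≤ (max 1 (max K₁ K₂)) ^ (2 * q) := Real.rpow_nonneg (by positivity) _
    calc (ν⁻¹ ^ 2) ^ q * ν = K₂ ^ (2 * q) * 1 := by rw [h3, mul_one]
      _ ≤ (max 1 (max K₁ K₂)) ^ (2 * q) * c ^ (5 - 3 * q) := mul_le_mul h2 h4 zero_le_one h5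

/-- **Lemma 14.2 for every viscosity from the case `ν = 1`.** The substitution
`u'(s, y) = ν⁻¹ u(t₀ + s/ν, x₀ + y)`, `p' = ν⁻² p ∘ Φ`, `f' = ν⁻² f ∘ Φ`
(`IsLRSuitableWeakSolutionOn.stRescale` with `α = β = ν⁻¹`, `γ = 1`) has viscosity `1`; it maps
`Q_{r₀}(z₀)` onto the slab `(-ν r₀², 0) × B(0, r₀)` and each `Q_r(z)` onto a cylinder of aspect
ratio `ν`, covered by `⌈2ν⌉ + 1` standard cylinders of radius `r` whose centres lie in the
`3/4`-cores of admissible cylinders of radius `min(1/2, √ν/2) r₀` inside the slab; radii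
`r > min(1/2, √ν/2) r₀ / 8` are handled by monotonicity. [cite: Lemarierieusset2023, §14.3 Lemma 14.2 (scan pp. 507–508)] -/
theorem lemma_14_2_of_nu_one
    (h1 : ∀ ⦃q : ℝ⦄, 5 / 3 ≤ q → ∃ ε₁ C₃ : ℝ, 0 < ε₁ ∧ 0 < C₃ ∧
      ∀ (Ω : Opens (ℝ × ℝ³)) (f u : ℝ → ℝ³ → ℝ³) (p : ℝ → ℝ³ → ℝ) (G : ℝ → ℝ³ → ℝ³ →L[ℝ] ℝ³),
        IsLRSuitableWeakSolutionOn Ω 1 q f u p G →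
        ∀ (z₀ : ℝ × ℝ³) (r₀ l : ℝ), 0 < r₀ →
          parabolicCylinder r₀ z₀ ⊆ (Ω : Set (ℝ × ℝ³)) → 0 ≤ l → l ≤ ε₁ →
          ∫⁻ w in parabolicCylinder r₀ z₀,
              (‖u w.1 w.2‖ₑ ^ (3 : ℕ) + ‖p w.1 w.2‖ₑ ^ (3 / 2 : ℝ)) ≤
            ENNReal.ofReal (l ^ 3 * r₀ ^ 2) →
          ∫⁻ w in parabolicCylinder r₀ z₀, ‖f w.1 w.2‖ₑ ^ q ≤
            ENNReal.ofReal (l ^ (2 * q) * r₀ ^ (5 - 3 * q)) →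
          ∀ z ∈ parabolicCylinder (3 * r₀ / 4) z₀, ∀ r : ℝ, 0 < r → r ≤ r₀ / 8 →
            ∫⁻ w in parabolicCylinder r z,
                (‖u w.1 w.2‖ₑ ^ (3 : ℕ) + ‖p w.1 w.2‖ₑ ^ (3 / 2 : ℝ)) ≤
              ENNReal.ofReal (C₃ * l ^ 3 * r ^ 2)) :
    lemarieRieusset_lemma_14_2 := by
  intro ν q hν hq
  obtain ⟨ε₁, C₃, hε₁, hC₃, H⟩ := h1 hq
  have hq0 : 0 < q := by linarith
  -- ### the constants
  set c : ℝ := min (1 / 2) (Real.sqrt ν / 2) with hc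
  have hc0 : 0 < c := lt_min (by norm_num) (by positivity)
  have hc1 : c ≤ 1 := (min_le_left _ _).trans (by norm_num)
  obtain ⟨K, hK1, hKa, hKb⟩ := transfer_constants hν hq hc0 hc1
  have hK0 : 0 < K := by linarith
  obtain ⟨C₃', hC₃'⟩ : ∃ C₃' : ℝ,
      C₃' = max (64 / c ^ 2) (ν ^ 2 * ((⌈2 * ν⌉₊ + 1 : ℕ) : ℝ) * C₃ * K ^ 3) := ⟨_, rfl⟩
  have hC₃'0 : 0 < C₃' := by rw [hC₃']; exact lt_of_lt_of_le (by positivity) (le_max_left _ _)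
  refine ⟨ε₁ / K, C₃', div_pos hε₁ hK0, hC₃'0, ?_⟩
  intro Q f u p G hS z₀ r₀ l hr₀ hsub hl hlε hUP hF z hz r hr hrr₀
  have hz' := hz
  rw [mem_parabolicCylinder] at hz'
  obtain ⟨⟨hz1, hz2⟩, hz3⟩ := hz'
  by_cases hsmall : r ≤ c * r₀ / 8
  swap
  · -- ### large radii: monotonicity
    have hlarge : c * r₀ / 8 < r := not_le.1 hsmall
    have hsubr : parabolicCylinder r z ⊆ parabolicCylinder r₀ z₀ :=
      parabolicCylinder_subset_of_mem_threeQuarters hz hr hrr₀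
    calc _ ≤ ENNReal.ofReal (l ^ 3 * r₀ ^ 2) := (lintegral_mono_set hsubr).trans hUP
      _ ≤ ENNReal.ofReal (C₃' * l ^ 3 * r ^ 2) := by
          refine ENNReal.ofReal_le_ofReal ?_
          have h64 : 64 / c ^ 2 ≤ C₃' := by rw [hC₃']; exact le_max_left _ _
          have hc2 : 0 < c ^ 2 := by positivity
          have h2 : r₀ ^ 2 ≤ 64 / c ^ 2 * r ^ 2 := by
            rw [div_mul_eq_mul_div, le_div_iff₀ hc2]
            nlinarith [mul_pos hc0 hr₀]
          calc l ^ 3 * r₀ ^ 2 ≤ l ^ 3 * (64 / c ^ 2 * r ^ 2) :=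
                mul_le_mul_of_nonneg_left h2 (pow_nonneg hl 3)
            _ = 64 / c ^ 2 * l ^ 3 * r ^ 2 := by ring
            _ ≤ C₃' * l ^ 3 * r ^ 2 := by gcongr
  -- ### small radii: the rescaled datum with viscosity `1`
  have hβ : (0 : ℝ) < ν⁻¹ := by positivity
  have hS' : IsLRSuitableWeakSolutionOn (stPreimage ν⁻¹ 1 z₀.1 z₀.2 Q) 1 q
      ((ν⁻¹ ^ 2 * 1) • stPull ν⁻¹ 1 z₀.1 z₀.2 f) (ν⁻¹ • stPull ν⁻¹ 1 z₀.1 z₀.2 u)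
      (ν⁻¹ ^ 2 • stPull ν⁻¹ 1 z₀.1 z₀.2 p) ((ν⁻¹ * 1) • stPull ν⁻¹ 1 z₀.1 z₀.2 G) := by
    have := hS.stRescale (α := ν⁻¹) (β := ν⁻¹) (γ := 1) hβ one_pos (mul_one _).symm z₀.1 z₀.2
    rwa [show ν⁻¹ * ν / 1 = 1 by field_simp] at this
  -- preimages of backward cylinders: stretched cylinders
  have hpre : ∀ (v : ℝ × ℝ³) (ρ : ℝ), stAffine ν⁻¹ 1 z₀.1 z₀.2 ⁻¹' parabolicCylinder ρ v =
      Ioo (ν * (v.1 - z₀.1) - ν * ρ ^ 2) (ν * (v.1 - z₀.1)) ×ˢ ball (v.2 - z₀.2) ρ := by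
    intro v ρ
    rw [parabolicCylinder, stAffine_preimage_cylinder hβ one_pos, inv_one, one_smul, div_one,
      div_inv_eq_mul, div_inv_eq_mul]
    congr 1
    congr 1 <;> ring
  have hpre0 : stAffine ν⁻¹ 1 z₀.1 z₀.2 ⁻¹' parabolicCylinder r₀ z₀ =
      Ioo (-(ν * r₀ ^ 2)) 0 ×ˢ ball (0 : ℝ³) r₀ := by
    rw [hpre, sub_self, sub_self, mul_zero, zero_sub]
  -- the pulled-back smallness integrand
  set Fs : ℝ × ℝ³ → ℝ≥0∞ := fun w => ‖u w.1 w.2‖ₑ ^ (3 : ℕ) + ‖p w.1 w.2‖ₑ ^ (3 / 2 : ℝ)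
    with hFs
  have hν3 : (ν⁻¹ ^ 2) ^ (3 / 2 : ℝ) = ν⁻¹ ^ 3 := sq_rpow_three_halves hβ.le
  have hpt : ∀ w : ℝ × ℝ³,
      ‖(ν⁻¹ • stPull ν⁻¹ 1 z₀.1 z₀.2 u) w.1 w.2‖ₑ ^ (3 : ℕ) +
        ‖(ν⁻¹ ^ 2 • stPull ν⁻¹ 1 z₀.1 z₀.2 p) w.1 w.2‖ₑ ^ (3 / 2 : ℝ) =
      ENNReal.ofReal (ν⁻¹ ^ 3) * Fs (stAffine ν⁻¹ 1 z₀.1 z₀.2 w) := by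
    intro w
    rw [smul_stPull_apply, smul_stPull_apply, enorm_smul, enorm_smul, mul_pow,
      ENNReal.mul_rpow_of_nonneg _ _ (by norm_num), Real.enorm_eq_ofReal hβ.le,
      Real.enorm_eq_ofReal (by positivity : (0 : ℝ) ≤ ν⁻¹ ^ 2), ← ENNReal.ofReal_pow hβ.le,
      ENNReal.ofReal_rpow_of_nonneg (by positivity) (by norm_num), hν3, hFs, mul_add]
    rfl
  have hJ : ENNReal.ofReal (ν⁻¹ * (1 : ℝ) ^ Module.finrank ℝ ℝ³)⁻¹ = ENNReal.ofReal ν := by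
    rw [one_pow, mul_one, inv_inv]
  have hscale : ∀ S : Set (ℝ × ℝ³),
      ∫⁻ w in stAffine ν⁻¹ 1 z₀.1 z₀.2 ⁻¹' S,
        (‖(ν⁻¹ • stPull ν⁻¹ 1 z₀.1 z₀.2 u) w.1 w.2‖ₑ ^ (3 : ℕ) +
          ‖(ν⁻¹ ^ 2 • stPull ν⁻¹ 1 z₀.1 z₀.2 p) w.1 w.2‖ₑ ^ (3 / 2 : ℝ)) =
      ENNReal.ofReal (ν⁻¹ ^ 3 * ν) * ∫⁻ v in S, Fs v := by
    intro S
    simp_rw [hpt]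
    rw [lintegral_const_mul' _ _ ENNReal.ofReal_ne_top,
      setLIntegral_preimage_comp_stAffine hβ one_pos z₀.1 z₀.2 Fs, hJ, ← mul_assoc,
      ← ENNReal.ofReal_mul (by positivity)]
  have hνν : ν⁻¹ ^ 3 * ν = (ν ^ 2)⁻¹ := by field_simp
  -- ### smallness on every unit-shape cylinder inside the slab
  set ρ : ℝ := c * r₀ with hρ
  have hρ0 : 0 < ρ := by positivity
  have hKl : 0 ≤ K * l := by positivity
  have hKlε : K * l ≤ ε₁ := by rwa [le_div_iff₀ hK0, mul_comm] at hlε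
  have hUP' : ∀ w : ℝ × ℝ³, parabolicCylinder ρ w ⊆ Ioo (-(ν * r₀ ^ 2)) 0 ×ˢ ball (0 : ℝ³) r₀ →
      ∫⁻ v in parabolicCylinder ρ w,
        (‖(ν⁻¹ • stPull ν⁻¹ 1 z₀.1 z₀.2 u) v.1 v.2‖ₑ ^ (3 : ℕ) +
          ‖(ν⁻¹ ^ 2 • stPull ν⁻¹ 1 z₀.1 z₀.2 p) v.1 v.2‖ₑ ^ (3 / 2 : ℝ)) ≤
        ENNReal.ofReal ((K * l) ^ 3 * ρ ^ 2) := by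
    intro w hw
    calc _ ≤ ∫⁻ v in stAffine ν⁻¹ 1 z₀.1 z₀.2 ⁻¹' parabolicCylinder r₀ z₀,
          (‖(ν⁻¹ • stPull ν⁻¹ 1 z₀.1 z₀.2 u) v.1 v.2‖ₑ ^ (3 : ℕ) +
            ‖(ν⁻¹ ^ 2 • stPull ν⁻¹ 1 z₀.1 z₀.2 p) v.1 v.2‖ₑ ^ (3 / 2 : ℝ)) := by
          rw [hpre0]; exact lintegral_mono_set hw
      _ = ENNReal.ofReal (ν⁻¹ ^ 3 * ν) * ∫⁻ v in parabolicCylinder r₀ z₀, Fs v := hscale _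
      _ ≤ ENNReal.ofReal (ν⁻¹ ^ 3 * ν) * ENNReal.ofReal (l ^ 3 * r₀ ^ 2) := by gcongr
      _ ≤ ENNReal.ofReal ((K * l) ^ 3 * ρ ^ 2) := by
          rw [← ENNReal.ofReal_mul (by positivity), hνν]
          refine ENNReal.ofReal_le_ofReal ?_
          calc (ν ^ 2)⁻¹ * (l ^ 3 * r₀ ^ 2) ≤ K ^ 3 * c ^ 2 * (l ^ 3 * r₀ ^ 2) :=
                mul_le_mul_of_nonneg_right hKa (by positivity)
            _ = (K * l) ^ 3 * ρ ^ 2 := by rw [hρ]; ring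
  have hF' : ∀ w : ℝ × ℝ³, parabolicCylinder ρ w ⊆ Ioo (-(ν * r₀ ^ 2)) 0 ×ˢ ball (0 : ℝ³) r₀ →
      ∫⁻ v in parabolicCylinder ρ w,
        ‖((ν⁻¹ ^ 2 * 1) • stPull ν⁻¹ 1 z₀.1 z₀.2 f) v.1 v.2‖ₑ ^ q ≤
        ENNReal.ofReal ((K * l) ^ (2 * q) * ρ ^ (5 - 3 * q)) := by
    intro w hw
    calc _ ≤ ∫⁻ v in stAffine ν⁻¹ 1 z₀.1 z₀.2 ⁻¹' parabolicCylinder r₀ z₀,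
          ‖((ν⁻¹ ^ 2 * 1) • stPull ν⁻¹ 1 z₀.1 z₀.2 f) v.1 v.2‖ₑ ^ q := by
          rw [hpre0]; exact lintegral_mono_set hw
      _ = ‖ν⁻¹ ^ 2 * (1 : ℝ)‖ₑ ^ q * ENNReal.ofReal ν *
            ∫⁻ v in parabolicCylinder r₀ z₀, ‖f v.1 v.2‖ₑ ^ q := by
          rw [setLIntegral_enorm_rpow_stRescale hβ one_pos z₀.1 z₀.2 (ν⁻¹ ^ 2 * 1) f _ hq0.le, hJ]
      _ ≤ ‖ν⁻¹ ^ 2 * (1 : ℝ)‖ₑ ^ q * ENNReal.ofReal ν *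
            ENNReal.ofReal (l ^ (2 * q) * r₀ ^ (5 - 3 * q)) := by gcongr
      _ = ENNReal.ofReal ((ν⁻¹ ^ 2) ^ q * ν * (l ^ (2 * q) * r₀ ^ (5 - 3 * q))) := by
          rw [mul_one, Real.enorm_eq_ofReal (by positivity : (0 : ℝ) ≤ ν⁻¹ ^ 2),
            ENNReal.ofReal_rpow_of_nonneg (by positivity) hq0.le,
            ← ENNReal.ofReal_mul (by positivity), ← ENNReal.ofReal_mul (by positivity)]
      _ ≤ ENNReal.ofReal ((K * l) ^ (2 * q) * ρ ^ (5 - 3 * q)) := by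
          refine ENNReal.ofReal_le_ofReal ?_
          have e1 : (K * l) ^ (2 * q) = K ^ (2 * q) * l ^ (2 * q) := Real.mul_rpow hK0.le hl
          have e2 : ρ ^ (5 - 3 * q) = c ^ (5 - 3 * q) * r₀ ^ (5 - 3 * q) := by
            rw [hρ]; exact Real.mul_rpow hc0.le hr₀.le
          rw [e1, e2]
          have h3 : 0 ≤ l ^ (2 * q) * r₀ ^ (5 - 3 * q) := by positivity
          calc (ν⁻¹ ^ 2) ^ q * ν * (l ^ (2 * q) * r₀ ^ (5 - 3 * q))
              ≤ K ^ (2 * q) * c ^ (5 - 3 * q) * (l ^ (2 * q) * r₀ ^ (5 - 3 * q)) :=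
                mul_le_mul_of_nonneg_right hKb h3
            _ = K ^ (2 * q) * l ^ (2 * q) * (c ^ (5 - 3 * q) * r₀ ^ (5 - 3 * q)) := by ring
  -- ### each covering cylinder is small-scale around an admissible centre
  set t' : ℝ := ν * (z.1 - z₀.1) with ht'
  set x' : ℝ³ := z.2 - z₀.2 with hx'
  have ht'1 : -(ν * (3 * r₀ / 4) ^ 2) < t' := by
    rw [ht']; nlinarith
  have ht'2 : t' < 0 := by rw [ht']; nlinarith
  have hx'n : ‖x'‖ < 3 * r₀ / 4 := by rwa [hx', ← dist_eq_norm]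
  have hrρ : r ≤ ρ / 8 := by rw [hρ]; linarith
  have hcov : ∀ k : Fin (⌈2 * ν⌉₊ + 1),
      ∫⁻ v in parabolicCylinder r (t' - k * r ^ 2 / 2, x'),
        (‖(ν⁻¹ • stPull ν⁻¹ 1 z₀.1 z₀.2 u) v.1 v.2‖ₑ ^ (3 : ℕ) +
          ‖(ν⁻¹ ^ 2 • stPull ν⁻¹ 1 z₀.1 z₀.2 p) v.1 v.2‖ₑ ^ (3 / 2 : ℝ)) ≤
        ENNReal.ofReal (C₃ * (K * l) ^ 3 * r ^ 2) := by
    intro k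
    have hk0 : (0 : ℝ) ≤ (k : ℕ) := Nat.cast_nonneg _
    have hkN : ((k : ℕ) : ℝ) ≤ 2 * ν + 1 := by
      have h1 : (k : ℕ) ≤ ⌈2 * ν⌉₊ := Nat.lt_succ_iff.1 k.2
      have h2 : ((k : ℕ) : ℝ) ≤ ⌈2 * ν⌉₊ := by exact_mod_cast h1
      linarith [Nat.ceil_lt_add_one (by positivity : (0 : ℝ) ≤ 2 * ν)]
    obtain ⟨w, hwk, hwsub⟩ := exists_base_center hν hr₀ hr hsmall hk0 hkN ht'1 ht'2 hx'n
    have hwΩ : parabolicCylinder ρ w ⊆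
        ((stPreimage ν⁻¹ 1 z₀.1 z₀.2 Q : Opens (ℝ × ℝ³)) : Set (ℝ × ℝ³)) := by
      rw [coe_stPreimage]
      refine hwsub.trans ?_
      rw [← hpre0]
      exact preimage_mono hsub
    exact H _ _ _ _ _ hS' w ρ (K * l) hρ0 hwΩ hKl hKlε (hUP' w hwsub) (hF' w hwsub) _ hwk r hr hrρ
  -- ### summing over the cover and scaling back
  have hcover : stAffine ν⁻¹ 1 z₀.1 z₀.2 ⁻¹' parabolicCylinder r z ⊆
      ⋃ k : Fin (⌈2 * ν⌉₊ + 1), parabolicCylinder r (t' - k * r ^ 2 / 2, x') := by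
    rw [hpre]
    exact stretched_subset_iUnion hν hr t' x'
  have hsum := lintegral_le_card_mul_of_subset_iUnion hcover _ hcov
  rw [hscale, hνν] at hsum
  -- `∫∫_{Q_r(z)} Fs = ν² · (ν⁻² ∫∫_{Q_r(z)} Fs) ≤ ν² N C₃ (Kλ)³ r²`
  have hν2 : ENNReal.ofReal (ν ^ 2) * ENNReal.ofReal ((ν ^ 2)⁻¹) = 1 := by
    rw [← ENNReal.ofReal_mul (by positivity), mul_inv_cancel₀ (by positivity), ENNReal.ofReal_one]
  calc ∫⁻ w in parabolicCylinder r z, Fs w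
      = ENNReal.ofReal (ν ^ 2) * (ENNReal.ofReal ((ν ^ 2)⁻¹) * ∫⁻ w in parabolicCylinder r z, Fs w) := by
        rw [← mul_assoc, hν2, one_mul]
    _ ≤ ENNReal.ofReal (ν ^ 2) * (((⌈2 * ν⌉₊ + 1 : ℕ) : ℝ≥0∞) *
          ENNReal.ofReal (C₃ * (K * l) ^ 3 * r ^ 2)) := by
        gcongr
    _ = ENNReal.ofReal (ν ^ 2 * ((⌈2 * ν⌉₊ + 1 : ℕ) : ℝ) * C₃ * K ^ 3 * l ^ 3 * r ^ 2) := by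
        rw [← ENNReal.ofReal_natCast, ← ENNReal.ofReal_mul (Nat.cast_nonneg _),
          ← ENNReal.ofReal_mul (by positivity)]
        congr 1
        ring
    _ ≤ ENNReal.ofReal (C₃' * l ^ 3 * r ^ 2) := by
        refine ENNReal.ofReal_le_ofReal ?_
        have h2 : ν ^ 2 * ((⌈2 * ν⌉₊ + 1 : ℕ) : ℝ) * C₃ * K ^ 3 ≤ C₃' := by
          rw [hC₃']; exact le_max_right _ _
        have h3 : 0 ≤ l ^ 3 * r ^ 2 := by positivity
        calc ν ^ 2 * ((⌈2 * ν⌉₊ + 1 : ℕ) : ℝ) * C₃ * K ^ 3 * l ^ 3 * r ^ 2 =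
            ν ^ 2 * ((⌈2 * ν⌉₊ + 1 : ℕ) : ℝ) * C₃ * K ^ 3 * (l ^ 3 * r ^ 2) := by
              ring
          _ ≤ C₃' * (l ^ 3 * r ^ 2) := mul_le_mul_of_nonneg_right h2 h3
          _ = C₃' * l ^ 3 * r ^ 2 := by ring

end Viscosity

end Lemma142

/-! ### The discharge -/

/-- **Lemarié-Rieusset's Lemma 14.2 holds** (P. G. Lemarié-Rieusset, *The Navier–Stokes
Problem in the 21st Century*, §14.3, Lemma 14.2, scan pp. 507–508): discharge of the named
fact `lemarieRieusset_lemma_14_2`. The unit-scale, unit-viscosity core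
(`Lemma142.lemma_14_2_unit_nu_one`: the iteration of the local energy bound, the
interpolation inequality and the pressure estimate with absorbed force along `θⁿ/16`), the
Navier–Stokes scaling (`Lemma142.lemma_14_2_nu_one`) and the covering reduction of the
viscosity (`Lemma142.lemma_14_2_of_nu_one`). [cite: Lemarierieusset2023, §14.3 Lemma 14.2 (scan pp. 507–508)] -/
theorem lemarieRieusset_lemma_14_2_holds : lemarieRieusset_lemma_14_2 :=
  Lemma142.lemma_14_2_of_nu_one fun _ hq => Lemma142.lemma_14_2_nu_one hq



end Literature.Analysis.FluidPDE
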